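import Summits.NavierStokesRegularity.NavierStokesRegularity.Theses.ExtremiserTransience
import Summits.NavierStokesRegularity.NavierStokesRegularity.Theorems.ExtremiserTransienceNearExtremalTransienceDSSLogMean
import Summits.NavierStokesRegularity.NavierStokesRegularity.Theorems.ExtremiserTransienceNearExtremalTransienceSharpConstant
import Literature.Analysis.FluidPDE.BlowupAncientSolution
import Literature.Analysis.FluidPDE.NSBoundedMildOseen
import Literature.Analysis.FluidPDE.MildSolution
import HarnessLib.Audit
import Summits.NavierStokesRegularity.NavierStokesRegularity.Theorems.ExtremiserTransienceNearExtremalTransienceExtremiserLiouvilleFarFieldLimit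
import Summits.NavierStokesRegularity.NavierStokesRegularity.Theorems.ExtremiserTransienceNearExtremalTransienceExtremiserLiouvillePlateau
import Literature.Analysis.FluidPDE.TaoEnstrophyLocalisation
import Literature.Analysis.FluidPDE.BarkerPrange2020VorticityAlignmentTypeIHolds
import Literature.Analysis.FluidPDE.KNSSMildGradientBound
import Literature.Analysis.FluidPDE.OseenHeatKernelBridge
import Literature.Analysis.FluidPDE.NSBoundedMildSmoothing
import Literature.Analysis.FluidPDE.TaoQuantitativeTotalSpeed
import Literature.Analysis.FluidPDE.TaoEnstrophyLocalisationProofs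
import Literature.Analysis.ODE.LipschitzFlow

/-!
# LINE g8-1 «bernoulli_liouville» — crux `ExtremiserTransience.NearExtremalTransience` (stmt-NavierStokesRegularity-21883)

Ideator seat ns-idea-10 (D-0145, generation 8, lens «rescuer»).  TARGET (concluded BY NAME by `NearExtremalTransience_of`):
`Summit.NavierStokesRegularity.NavierStokesRegularity.Theses.ExtremiserTransience.NearExtremalTransience`.  No summit is proved by a
line; nothing here proves NS regularity; the stubs are `sorry`s by design.

## The corpse and the dodge

Line B (`Lines/extremiser_liouville.lean`, skeleton of record) and line g7-3 (`Lines/l2_budget.lean`) reduce the crux to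
K2 (persistence compactifies: an EXTREMAL ANCIENT SOLUTION exists) + K1a (analytic slices) + K1b (STATIC Liouville: no analytic
constant-speed extended extremiser).  K1b is where five generations of the K1b seat stand: every residue object has an exact KKT
multiplier, zero barycentre, a far-field drift `c`, constant speed `‖w‖ ≡ M` … and the recorded wall is the TAIL/JET regime between
`|x|⁻¹` and `|x|^{-3/2}` (l2_budget's stubs T/F; the jet alternative of the axial dossier).  All of it is STATIC: it interrogates ONE slice.

THE DODGE: K2's object is not a slice, it is a SOLUTION.  Its slices are extremal for a.e. `t ∈ (a,b)`, hence (landed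
`ext_interior_contact_nonempty_of_extremal` + K1a + identity theorem + continuity in `t`) of CONSTANT SPEED `‖W(t,x)‖ = M(t)` on a whole
time window (T1).  Dot Navier–Stokes with `W`: since `|W|² = M(t)²` does not depend on `x`,
`⟪W, ∇p⟫ = −|DW|²_F − M M′` POINTWISE — the pressure drops at the constant rate `MM′` plus the local dissipation density ALONG EVERY
STREAMLINE of the frozen slice (T3, the Bernoulli drop law).  A finite-enstrophy slice has a far-field drift `c`, `‖c‖ = M > 0`, with
`W → c`, `DW → 0` (T2) and `p → 0` at infinity (T3, mild pressure `RᵢRⱼ(wᵢwⱼ)`, `w = W − c ∈ L⁶`).  Far off the drift axis a streamline runs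
from infinity to infinity; `p` starts and ends at `0` while strictly dropping wherever `DW ≠ 0`: so `M′ = 0` and `DW ≡ 0` along it — the
slice is flat on an open set (T4), hence everywhere (K1a), contradicting `M‖ω‖₂‖∇ω‖₂ > 0`.  K1b is never invoked: the line survives even
if analytic constant-speed extended extremisers EXIST (K1b's recorded risk), because none of them can sit inside an ancient solution for
a time window.

## Stubs (3 since REV 1.5: K2, T2b, T3; sorries only inside them) + T1, K1a, T2(a), T4 PROVED

* K2  `stub_extremalPersistenceCompactness` — XL, SHARED with line B verbatim; the load-bearing stub of every line on this crux.
* K1a `analyticSlices` — PROVED sorry-free in REV 1.3 (port of the tree's `IsTypeIAncientMild.analyticOnNhd_slice_univ` to the bounded class: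
  `lemarieRieusset2016_local_analyticity_holds` + `oseenMild_bounded_unique` + `analyticOnNhd_slice`; std axioms).  Was the SHARED stub `stub_analyticSlices`.
* T1  `constSpeedAccumulation` — PROVED sorry-free in REV 1.2 (accumulation form of REV 1.1; `extendedSharp` + `ExtremiserLiouville.norm_eq_of_analytic_extremal`
  + `norm_curl_le` per slice, `Real.volume_Ioo` for «a.e. ⇒ somewhere in every sub-interval»; std axioms).
* T2  `farField` — part (a) (the far-field VALUE `W(t₀) → c`) PROVED in REV 1.4: `knss_fderiv_bounded` (KNSS (4.6) `k = 1`: the tree's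
  `IsKNSSDriftMild.exists_gradient_bound` on the clamped, time-shifted window field) + `exists_farFieldLimit`; the OPEN remainder is
  T2b `stub_farFieldGradient` — M (`DW(t₀) → 0`; needs the level-`1+β` / Hessian a-priori bound for the bounded class, not in tree).
* T3  `stub_bernoulliPressure` — L, known mechanism (mild pressure formula, the drop identity, `L³` decay).  HARDEST NEW STUB.
* T4  `bernoulliLiouville` — THE LEVER, PROVED sorry-free in REV 1.5 (≈ 330 lines, std axioms): global streamlines
  `Literature.Analysis.ODE.lipschitzFlow`; the escape lemma `T4Proof.escape` (bounded crossing time + bootstrap); `q ∘ γ` antitone with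
  equal limits; the `m < 0` branch dies because `(q ∘ γ)′ → −m > 0` along an escaping streamline.
Composition: `extremalAncient_false_of_bernoulli : K1a → T1 → T2 → T3 → T4 → K1` (PROVED below) and `NearExtremalTransience_of`
(line B's block-to-log bookkeeping, copied character-identically from `Lines/l2_budget.lean`, with K1 now fed by the dynamic rigidity).

## Why this line / why novel / bears_on / falsifier / instrument

* WHY: it deletes K1b (director's KEY-NS blocker, HOURLY-NS BLOCK 95) from line B's residual, leaving K2 + four known-mechanism stubs;
  the residual difficulty of the crux becomes exactly K2 (persistence compactness), which every line on 21883/26567 shares anyway.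
* NOVEL vs the cone: (i) line B / l2_budget / the K1b dossier (`…ConstantSpeed*`) are static one-slice Liouville arguments (E–L multiplier,
  residue jets, Fourier budgets); none uses the time variable.  (ii) `Theorems.ExtremiserTransience.PlateauSliceRigidity`
  (`sliceConstantSpeed`, `plateauSliceRigidity`, stmt-27823) kills constant-speed slices of TYPE-I-DECAYING ancient fields by the subcubic
  local-energy budget `∫_{B_ρ}|W|² ≤ Cρ^{11/4}` against cubic mass growth — it needs `√(−t)‖W(t)‖∞ ≤ K`, which K2's KNSS limit (Type-I
  constants `C_n → ∞` along the persisting flows; only `|W| ≤ 1`) does NOT have; this line uses the finite Dirichlet budget of the slice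
  and the pressure instead, and works in the bounded ancient class.  (iii) ns-idea-5's β line (`Cruxes/NearExtremalTransiencePerFlow/
  Lines/filament_selection.lean`) is per-flow (26567) and Type-I throughout.  Searched: `rg "Bernoulli|streamline" Cruxes/ Theorems/`
  (no dynamic use), corpus+galaxy «constant speed Navier–Stokes ancient», «Bernoulli pressure Liouville Navier–Stokes» (nearest print:
  Liouville theorems for bounded ancient solutions under sign/decay conditions on the head pressure `|W|²/2 + p` — Koch–Nadirashvili–
  Seregin–Šverák 2009, Seregin–Šverák head-pressure Liouville; none assumes or derives constant speed; the delta is that extremality GIVES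
  constant speed, which linearises Bernoulli's law into a one-line monotone quantity).
* bears_on: LADDER-NS rung ET/21883 (aside) and, via the same K2/K1 split, the load-bearing 26567 (`NearExtremalTransiencePerFlow` ⇐
  `NearExtremalTransience`, tree `ExtremiserTransience.nearExtremalTransiencePerFlow_of_uniform`-shaped monotonicity); K1b seat el-k1b.
* CHEAPEST FALSIFIER: exhibit a smooth NS solution on a time interval with constant-speed slices, FINITE positive enstrophy and a far-field
  drift — T3+T4 say none exists.  The known constant-speed NS solutions (`e^{−t}(cos z, sin z, 0)`, ABC/Beltrami-type `e^{−t}B(x)`) have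
  INFINITE enstrophy and `DW ↛ 0`: they satisfy the drop identity with `∇p = 0`, `m = −e^{−2t} ≠ 0`, and escape T4 only through `DW ↛ 0` —
  the finite budget is used essentially.  Instrument row that would refute the key lemma T4: any `C²` constant-speed field on `ℝ³` with
  `DV ∈ L²`, `DV → 0`, NOT locally flat far off-axis, admitting a decaying potential with the drop identity (a kit search over helical
  perturbations `c + ε h(x)` of a drift at second order in ε is the cheapest probe: at O(ε) the identity forces `⟪c,∇q₁⟫ = 0`, at O(ε²)
  `⟪c,∇q₂⟫ = −|Dh|² − ⟪h,∇q₁⟫`, and integrating along the `c`-lines gives `∫|Dh|² = 0` line by line — the linearised statement holds).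

## REV 1.1 (2026-08-29, answers idea-crit-8 V95 PASS-WITH-PRICE P1–P3; composition unchanged in shape, kernel-checked)

* P1(b) TYPED — ACCUMULATION FORM.  T1 is now `stub_constSpeedAccumulation`: ONE extremal time `t₀ ∈ (a,b)` with constant speed
  `M(t₀) > 0` that is an accumulation point of constant-speed times `s n → t₀` (+ slice data); T3 takes that sequence instead of a window
  and derives the `x`-independence of `∂ₜ|W|²(t₀,x) = lim (M(s n)² − M(t₀)²)/(s n − t₀)` from it (no `M′`).  THE MINIMAL CLAUSE K2 MUST
  DELIVER for this line is therefore K2-acc «an extremal finite-budget time at which extremal times accumulate» — implied by K2 as typed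
  (a full-measure set of extremal times contains one of its accumulation points), strictly less than an interval, strictly more than line
  B's single slice.  P1(a) acknowledged: this line does NOT retire l2_budget's T-i-a/b/c + F; the residual of record on 21883 reads
  «K2 ∧ K1a ∧ [(T1 ∧ T2 ∧ T3 ∧ T4) ∨ (T-i ∧ F)]».  The companion LINE g8-2 «record_instant» (this seat, `Lines/record_instant.lean`) types
  the ONE-INSTANT branch: a single extremal slice that is a backward amplitude record gives the SIGNED drop law `⟪W,∇p⟫ ≤ −|DW|²_F`.
* P2 — T4's escape is argued by BOUNDED CROSSING TIME (bootstrap on the axial coordinate; see `Sig.T4`), not by a transversal-speed rate.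
* P3 — T3 bookkeeping made explicit in `Sig.T3`: classical `∂ₜW` from `IsKNSSBlowupLimit.smooth`; `q := p(t₀,·)` with the mild
  representation, normalisation fixed by `p → 0`; the slope `m` is the common value of the `x`-independent difference quotients.
No summit is proved by a line; K2, K1a, T1–T4, 21883 and NS regularity remain OPEN.

## REV 1.2 (2026-08-29, unprompted de-risking after V98 «prices PAID, line STANDS as PASS»; statements UNCHANGED)

* T1 PROVED: `theorem constSpeedAccumulation : Sig.T1` (≈ 90 lines with the helpers `slice_constSpeed`, `exists_mem_Ioo_of_ae`; the helper
  predicate `SLICE W t` is the a.e.-clause of `Sig.T1` verbatim).  Def-diff vs REV 1.1: every `Sig.*` Prop identical; `stub_constSpeedAccumulation`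
  removed / `constSpeedAccumulation` added with the same statement — V98a's probe numbers carry over.  Open stubs: K2, K1a, T2, T3, T4.

## REV 1.3 (2026-08-29, unprompted de-risking; statements UNCHANGED)

* K1a PROVED: `theorem analyticSlices : Sig.K1A` (≈ 70 lines), the shared «port» stub of line B / l2_budget / record_instant — Lemarié-Rieusset's
  local analyticity (tree, PROVED form) from the bounded datum `W s₁` (`M = 2`, window `ε/4`), identified with `W` by bounded Oseen-mild
  uniqueness (K2's Oseen-gauge representation is exactly the hypothesis).  Def-diff vs REV 1.2: every `Sig.*` Prop identical;
  `stub_analyticSlices` removed / `analyticSlices` added with the same statement; one new import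
  (`Literature.Analysis.FluidPDE.BarkerPrange2020VorticityAlignmentTypeIHolds`).  Open stubs: K2 (XL, shared), T2 (M), T3 (L), T4 (M).

## REV 1.4 (2026-08-29, unprompted de-risking; every `Sig.*` Prop of REV 1.3 UNCHANGED, one Prop ADDED)

* T2 part (a) PROVED: `knss_fderiv_bounded` (every negative-time slice of a KNSS limit in the Oseen gauge has bounded gradient — the
  tree's `IsKNSSDriftMild.exists_gradient_bound`, KNSS (4.6) with `k = 1`, applied to `V t := W (t₀ − 1 + clamp t)`, which is drift-mild
  with `b = 0`, `N = 1` by `driftDuhamel_zero_eq_oseenDuhamel` + `oseenDuhamel_translate`) and `farFieldValue` (`∃ c, W(t₀) → c` along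
  `cocompact`, from `exists_farFieldLimit`); both std axioms.  `farField : Sig.T2` is now the composition of `farFieldValue` with the
  NEW, strictly smaller stub `stub_farFieldGradient : Sig.T2b` (`DW(t₀) → 0` at infinity — the level-`1+β` estimate, not in tree).
  Def-diff vs REV 1.3: `Sig.T2b` added; `stub_farField` removed / `farField` added with the statement `Sig.T2` unchanged; four imports added
  (`KNSSMildGradientBound`, `OseenHeatKernelBridge`, `NSBoundedMildSmoothing`, `TaoQuantitativeTotalSpeed`).  Probes on `Sig.T2b`: BC2 9/9
  must-fail FAILED (↛ 21883, ↛ 26567, ↛ summit, not provable outright, ↛ T2, ↛ K1; 21883 ↛ T2b, summit ↛ T2b, and even the true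
  converse T2 → T2b is not found by the cheap battery); BC7 3/3 `VERDICT: CLEAN` (vs summit, 21883, 26567).  Side remark for K2's prover:
  the clause `∃ B, ∀ x, ‖fderiv ℝ (W t) x‖ ≤ B` in K2's slice data is automatic for KNSS limits (`knss_fderiv_bounded`).
  Open stubs: K2 (XL, shared), T2b (M), T3 (L), T4 (M).

## REV 1.5 (2026-08-29, unprompted de-risking; every `Sig.*` Prop of REV 1.4 UNCHANGED, none added)

* T4 PROVED: `theorem bernoulliLiouville : Sig.T4` — THE LEVER of the line is now a theorem (std axioms).  Ingredients (all in `section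
  T4Proof`): `T4Proof.escape` (a curve of speed `≤ M` whose driving field has axial component `≥ M/2` outside `B_R`, started at axial
  coordinate `≥ −A` and norm `≥ R + 2(R+A) + 2`, satisfies `‖γ s‖ ≥ R + (M/2)(s − τ)` for `s ≥ τ = (2(R+A)+2)/M` — interval monotonicity
  `Convex.mul_sub_le_image_sub_of_le_deriv` + the bootstrap via `IsClosed.csInf_mem`); `T4Proof.exists_escaping_streamlines` (`|c| = M`,
  far-field threshold from `hasBasis_cobounded_compl_closedBall`, the global flow `Literature.Analysis.ODE.lipschitzFlow`, time reversal
  for the backward escape, the open set `{|⟪x,e⟫| < 1, ‖x‖ > 3R + 4}`); `T4Proof.bernoulliLiouvilleSign` (the signed form `Dq(V) ≤ −|DV|²_F`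
  suffices: `q ∘ γ` antitone (`antitone_of_deriv_nonpos`) with limits `0` at `±∞` ⇒ constant ⇒ `|DV(x₀)|²_F ≤ 0` ⇒ `DV(x₀) = 0` by
  `sq_opNorm_le_frobeniusNormSq`); `T4Proof.bernoulliLiouville` (`m ≥ 0` ⇒ signed form; `m < 0` impossible since `(q∘γ)′ = −|DV(γ)|²_F − m
  → −m > 0` along an escaping streamline while `q ∘ γ → 0`).  Note: the hypothesis `DV → 0` at infinity is used ONLY in the `m < 0`
  branch; the signed form does not need it.  Def-diff vs REV 1.4: every `Sig.*` Prop identical; `stub_bernoulliLiouville` removed /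
  `bernoulliLiouville` added (statement `Sig.T4` unchanged); two imports added (`TaoEnstrophyLocalisationProofs`, `ODE.LipschitzFlow`).
  Open stubs: K2 (XL, shared), T2b (M), T3 (L) — the line's remaining NEW content is T3 (mild pressure / Bernoulli drop law) alone.
-/

noncomputable section

open Set Filter Topology MeasureTheory Metric Function
open scoped ENNReal NNReal Topology InnerProductSpace RealInnerProductSpace ContDiff Laplacian
open Literature.Analysis.FluidPDE Literature.Analysis

namespace Summit.NavierStokesRegularity.NavierStokesRegularity.Cruxes.NearExtremalTransience.BernoulliLiouville

open Summit.NavierStokesRegularity.NavierStokesRegularity.Theses.ExtremiserTransience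
open Summit.NavierStokesRegularity.NavierStokesRegularity.Theorems
open Summit.NavierStokesRegularity.NavierStokesRegularity.Theorems.DepletionLadder
open Summit.NavierStokesRegularity.NavierStokesRegularity.Theorems.DepletionLadder.KStar
open Summit.NavierStokesRegularity.NavierStokesRegularity.Theorems.DepletionLadder.KStar.HalfSpace
open Summit.NavierStokesRegularity.NavierStokesRegularity.Theorems.RungReynoldsOne.WeightedSlice

set_option linter.unusedVariables false
set_option linter.dupNamespace false
set_option linter.style.longLine false

/-! ## Named signatures of this line's four new stubs (T1–T4) and of the two statements they serve (K1A = line B's K1a, K1 = «no extremal ancient solution») -/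

namespace Sig

/-- K1a's statement (line B `stub_analyticSlices`, shared verbatim): slices of a KNSS blow-up limit in the Oseen gauge are real-analytic. -/
def K1A : Prop :=
  ∀ (W : ℝ → EuclideanSpace ℝ (Fin 3) → EuclideanSpace ℝ (Fin 3)), (Literature.Analysis.FluidPDE.IsKNSSBlowupLimit W ∧ (∀ s t : ℝ, s < t → t < 0 → ∀ x, W t x = Literature.Analysis.FluidPDE.heatFlow (W s) (t - s) x - Literature.Analysis.FluidPDE.oseenDuhamel 1 s W W t x)) → ∀ t : ℝ, t < 0 → AnalyticOnNhd ℝ (W t) Set.univ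

/-- K1 — RIGIDITY, dynamic form (line B): there is NO extremal ancient solution, i.e. no KNSS blow-up limit in the Oseen gauge whose
slices are extremal (finite enstrophy/palinstrophy budget, `M‖ω‖₂‖∇ω‖₂ > 0`, EQUALITY in the extended sharp inequality) for a.e. time of
an interval `(a,b)`, `b ≤ 0`.  Line B proves K1 from K1a + K1b (static Liouville); THIS line proves K1 from K1a + T1–T4 (dynamic). -/
def K1 : Prop :=
  ¬ (∃ (W : ℝ → EuclideanSpace ℝ (Fin 3) → EuclideanSpace ℝ (Fin 3)) (a b : ℝ), (Literature.Analysis.FluidPDE.IsKNSSBlowupLimit W ∧ (∀ s t : ℝ, s < t → t < 0 → ∀ x, W t x = Literature.Analysis.FluidPDE.heatFlow (W s) (t - s) x - Literature.Analysis.FluidPDE.oseenDuhamel 1 s W W t x)) ∧ a < b ∧ b ≤ 0 ∧ ∀ᵐ t : ℝ, t ∈ Set.Ioo a b → (ContDiff ℝ (⊤ : ℕ∞) (W t) ∧ Literature.Analysis.FluidPDE.VectorCalculus.IsDivFree (W t) ∧ (∃ B : ℝ, ∀ x, ‖fderiv ℝ (W t) x‖ ≤ B) ∧ (∫⁻ x,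 ‖iteratedFDeriv ℝ 1 (W t) x‖ₑ ^ 2 < ⊤) ∧ (∫⁻ x, ‖iteratedFDeriv ℝ 2 (W t) x‖ₑ ^ 2 < ⊤) ∧ ∃ M : ℝ, (∀ x, ‖(W t) x‖ ≤ M) ∧ 0 < M * Real.sqrt (∫ x, ‖Literature.Analysis.FluidPDE.curl (W t) x‖ ^ 2) * Real.sqrt (∫ x, Literature.Analysis.FluidPDE.frobeniusNormSq (fderiv ℝ (Literature.Analysis.FluidPDE.curl (W t)) x)) ∧ (sInf {κ : ℝ | (∀ (v : EuclideanSpace ℝ (Fin 3) → EuclideanSpace ℝ (Fin 3)) (M B : ℝ), ContDiff ℝ (⊤ : ℕ∞) v → Literature.Analysis.FluidPDE.VectorCalculus.IsDivFree v → (∀ x, ‖v x‖ ≤ M) → (∀ x, ‖fderiv ℝ v x‖ ≤ B) → (∫⁻ x, ‖iteratedFDeriv ℝ 0 v x‖ₑ ^ 2 < ⊤) → (∫⁻ x, ‖iteratedFDeriv ℝ 1 v x‖ₑ ^ 2 < ⊤) → (∫⁻ x, ‖iteratedFDeriv ℝ 2 v x‖ₑ ^ 2 < ⊤) → |∫ x,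 ⟪Literature.Analysis.FluidPDE.curl v x, fderiv ℝ v x (Literature.Analysis.FluidPDE.curl v x)⟫_ℝ| ≤ κ * M * Real.sqrt (∫ x, ‖Literature.Analysis.FluidPDE.curl v x‖ ^ 2) * Real.sqrt (∫ x, Literature.Analysis.FluidPDE.frobeniusNormSq (fderiv ℝ (Literature.Analysis.FluidPDE.curl v) x)))}) * M * Real.sqrt (∫ x, ‖Literature.Analysis.FluidPDE.curl (W t) x‖ ^ 2) * Real.sqrt (∫ x, Literature.Analysis.FluidPDE.frobeniusNormSq (fderiv ℝ (Literature.Analysis.FluidPDE.curl (W t)) x)) ≤ |∫ x, ⟪Literature.Analysis.FluidPDE.curl (W t) x, fderiv ℝ (W t) x (Literature.Analysis.FluidPDE.curl (W t) x)⟫_ℝ|))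

/-- T1 (`stub_constSpeedAccumulation`, M — provable from the tree today; REV 1.1 = the ACCUMULATION FORM asked by idea-crit-8 V95 P1(b)):
an extremal ancient solution has an extremal time `t₀ ∈ (a,b)` of CONSTANT SPEED `‖W(t₀,·)‖ ≡ M(t₀) > 0` that is an ACCUMULATION POINT of
constant-speed times `s n → t₀` (`s n ≠ t₀`, `‖W(s n,·)‖ ≡ M(s n)`), plus the slice data at `t₀`.  HOW LITTLE OF THE INTERVAL IS USED: only
that the set `E` of extremal times in `(a,b)` contains one of its own accumulation points — automatic for a full-measure (indeed for any
uncountable) `E`; no window, no continuity in `t` of the speed.  Each extremal slice has constant speed: equality in `extendedSharp` ⇒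
`(interior {‖W t‖ = M}).Nonempty` (tree `ExtremiserLiouville.ext_interior_contact_nonempty_of_extremal`) ⇒ with K1a the analytic `‖W t‖²` is
constant (identity theorem on connected `ℝ³`); `0 < M(t₀)` and `∃ x, DW(t₀,x) ≠ 0` from `0 < M‖ω‖₂‖∇ω‖₂`.  The MINIMAL CLAUSE K2 must
deliver for this line (K2-acc): «some extremal finite-budget time `t₀ < 0` at which extremal times accumulate» — implied by K2 as typed.
Why it might fail: it should not. -/
def T1 : Prop :=
  ∀ (W : ℝ → EuclideanSpace ℝ (Fin 3) → EuclideanSpace ℝ (Fin 3)) (a b : ℝ), (Literature.Analysis.FluidPDE.IsKNSSBlowupLimit W ∧ (∀ s t : ℝ, s < t → t < 0 → ∀ x, W t x = Literature.Analysis.FluidPDE.heatFlow (W s) (t - s) x - Literature.Analysis.FluidPDE.oseenDuhamel 1 s W W t x)) → a < b → b ≤ 0 →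
      (∀ᵐ t : ℝ, t ∈ Set.Ioo a b → (ContDiff ℝ (⊤ : ℕ∞) (W t) ∧ Literature.Analysis.FluidPDE.VectorCalculus.IsDivFree (W t) ∧ (∃ B : ℝ, ∀ x, ‖fderiv ℝ (W t) x‖ ≤ B) ∧ (∫⁻ x, ‖iteratedFDeriv ℝ 1 (W t) x‖ₑ ^ 2 < ⊤) ∧ (∫⁻ x, ‖iteratedFDeriv ℝ 2 (W t) x‖ₑ ^ 2 < ⊤) ∧ ∃ M : ℝ, (∀ x, ‖(W t) x‖ ≤ M) ∧ 0 < M * Real.sqrt (∫ x, ‖Literature.Analysis.FluidPDE.curl (W t) x‖ ^ 2) * Real.sqrt (∫ x, Literature.Analysis.FluidPDE.frobeniusNormSq (fderiv ℝ (Literature.Analysis.FluidPDE.curl (W t)) x)) ∧ (sInf {κ : ℝ | (∀ (v : EuclideanSpace ℝ (Fin 3) → EuclideanSpace ℝ (Fin 3)) (M B : ℝ), ContDiff ℝ (⊤ : ℕ∞) v → Literature.Analysis.FluidPDE.VectorCalculus.IsDivFree v → (∀ x, ‖v x‖ ≤ M) → (∀ x, ‖fderiv ℝ v x‖ ≤ B)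 → (∫⁻ x, ‖iteratedFDeriv ℝ 0 v x‖ₑ ^ 2 < ⊤) → (∫⁻ x, ‖iteratedFDeriv ℝ 1 v x‖ₑ ^ 2 < ⊤) → (∫⁻ x, ‖iteratedFDeriv ℝ 2 v x‖ₑ ^ 2 < ⊤) → |∫ x, ⟪Literature.Analysis.FluidPDE.curl v x, fderiv ℝ v x (Literature.Analysis.FluidPDE.curl v x)⟫_ℝ| ≤ κ * M * Real.sqrt (∫ x, ‖Literature.Analysis.FluidPDE.curl v x‖ ^ 2) * Real.sqrt (∫ x, Literature.Analysis.FluidPDE.frobeniusNormSq (fderiv ℝ (Literature.Analysis.FluidPDE.curl v) x)))}) * M * Real.sqrt (∫ x, ‖Literature.Analysis.FluidPDE.curl (W t) x‖ ^ 2) * Real.sqrt (∫ x, Literature.Analysis.FluidPDE.frobeniusNormSq (fderiv ℝ (Literature.Analysis.FluidPDE.curl (W t)) x)) ≤ |∫ x, ⟪Literature.Analysis.FluidPDE.curl (W t) x, fderiv ℝ (W t) x (Literature.Analysis.FluidPDE.curl (W t) x)⟫_ℝ|)) →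
      (∀ t : ℝ, t < 0 → AnalyticOnNhd ℝ (W t) Set.univ) →
      ∃ (t₀ : ℝ) (M : ℝ → ℝ) (s : ℕ → ℝ), a < t₀ ∧ t₀ < b ∧
        (∀ n, s n ≠ t₀ ∧ s n < 0 ∧ ∀ x, ‖W (s n) x‖ = M (s n)) ∧ Tendsto s atTop (𝓝 t₀) ∧
        (∀ x, ‖W t₀ x‖ = M t₀) ∧ 0 < M t₀ ∧ ContDiff ℝ 2 (W t₀) ∧
        (∃ B : ℝ, ∀ x, ‖fderiv ℝ (W t₀) x‖ ≤ B) ∧ (∫⁻ x, ‖iteratedFDeriv ℝ 1 (W t₀) x‖ₑ ^ 2 < ⊤) ∧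
        (∃ x, fderiv ℝ (W t₀) x ≠ 0)

/-- T2 (`stub_farField`, M — known mechanism): FAR-FIELD PACKAGE of a finite-enstrophy slice of a KNSS limit: a constant drift `c`
with `W(t₀,x) → c` and `DW(t₀,x) → 0` as `‖x‖ → ∞`.  Tree: `ExtremiserLiouville.exists_farFieldLimit` (Galdi II.6.1: `‖w‖ ≤ M`,
`‖Dw‖ ≤ B`, `Dw ∈ L²` ⇒ `w → c`, `w − c ∈ L⁶`) gives the drift once `DW(t₀)` is bounded; `DW(t₀) → 0` from `DW(t₀) ∈ L²` plus
uniform continuity (`D²W(t₀)` bounded).  The derivative bounds `sup‖DᵏW(t₀)‖ < ∞` are KNSS 2009 §4 (bounded mild ⇒ smooth with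
bounds on every slice; tree `KNSS2009_lemma61_*`, `NSBoundedMildOseen`).  Why it might fail: it should not; the work is the slice-wise
derivative bounds for the bounded (not Type-I) ancient class. -/
def T2 : Prop :=
  ∀ (W : ℝ → EuclideanSpace ℝ (Fin 3) → EuclideanSpace ℝ (Fin 3)), (Literature.Analysis.FluidPDE.IsKNSSBlowupLimit W ∧ (∀ s t : ℝ, s < t → t < 0 → ∀ x, W t x = Literature.Analysis.FluidPDE.heatFlow (W s) (t - s) x - Literature.Analysis.FluidPDE.oseenDuhamel 1 s W W t x)) → ∀ t₀ : ℝ, t₀ < 0 →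
      (∫⁻ x, ‖iteratedFDeriv ℝ 1 (W t₀) x‖ₑ ^ 2 < ⊤) →
      ∃ c : EuclideanSpace ℝ (Fin 3), Tendsto (W t₀) (cocompact (EuclideanSpace ℝ (Fin 3))) (𝓝 c) ∧
        Tendsto (fun x => fderiv ℝ (W t₀) x) (cocompact (EuclideanSpace ℝ (Fin 3))) (𝓝 0)

/-- T2b (`stub_farFieldGradient`, M — the OPEN remainder of T2 since REV 1.4; part (a) of T2, the far-field VALUE, is PROVED below as
`farFieldValue` via the KNSS gradient bound `knss_fderiv_bounded`): the slice GRADIENT of a KNSS limit in the Oseen gauge decays at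
infinity when `DW(t₀) ∈ L²`.  Mechanism: `DW(t₀) ∈ L²` plus UNIFORM CONTINUITY of `DW(t₀)` (a level-2 / Hölder-gradient a-priori bound
for bounded mild ancient solutions, KNSS 2009 (4.6) with `k = 2` — NOT yet in the tree, whose `KNSSMildGradientBound` stops at level 1)
⇒ `DW(t₀,x) → 0`.  Why it might fail: it should not; the work is the level-`1+β` estimate for the bounded class. -/
def T2b : Prop :=
  ∀ (W : ℝ → EuclideanSpace ℝ (Fin 3) → EuclideanSpace ℝ (Fin 3)), (Literature.Analysis.FluidPDE.IsKNSSBlowupLimit W ∧ (∀ s t : ℝ, s < t → t < 0 → ∀ x, W t x = Literature.Analysis.FluidPDE.heatFlow (W s) (t - s) x - Literature.Analysis.FluidPDE.oseenDuhamel 1 s W W t x)) → ∀ t₀ : ℝ, t₀ < 0 →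
      (∫⁻ x, ‖iteratedFDeriv ℝ 1 (W t₀) x‖ₑ ^ 2 < ⊤) →
      Tendsto (fun x => fderiv ℝ (W t₀) x) (cocompact (EuclideanSpace ℝ (Fin 3))) (𝓝 0)

/-- T3 (`stub_bernoulliPressure`, L — known mechanism, the one heavy stub; REV 1.1 accumulation form): the BERNOULLI DROP LAW.  At a
constant-speed time `t₀ < 0` (`‖W(t₀,·)‖ ≡ M(t₀)`) that is a limit of constant-speed times `s n → t₀`, the MILD pressure satisfies POINTWISE
`⟪W, ∇p⟫ = −|DW|²_F − m` with ONE constant `m`, and `p(t₀,x) → 0` at infinity.  Bookkeeping (V95 P3): (i) `W` is `C^∞` on `(−∞,0)×ℝ³`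
(`IsKNSSBlowupLimit.smooth`), so `f_x(t) = |W(t,x)|²/2` is `C¹` near `t₀` and `f_x′(t₀) = lim_n (M(s n)² − M(t₀)²)/(2(s n − t₀))` — the
difference quotients do not depend on `x`, hence neither does the limit: `f_x′(t₀) = m` for all `x` (this replaces `M M′(t₀)` of rev 1; no
differentiability of `M` is claimed); the Oseen-gauge identity makes `W` a classical NS solution there, and dotting NS with `W` gives
`m + W·∇(|W|²/2) + W·∇p = Δ(|W|²/2) − |DW|²_F` with the two spatial terms of `|W(t₀,·)|² ≡ M(t₀)²` vanishing; (ii) `q := p(t₀,·)` with the MILD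
representation `p = RᵢRⱼ(wᵢwⱼ)`, `w = W(t₀) − c ∈ L⁶` (cross terms vanish because `div w = 0`; tree analogue
`pressure_eq_pressurePotentialMod_add_const_of_oseenMild`), the additive normalisation FIXED by `p → 0` (`p ∈ L³ ∩ C¹`, `∇p` bounded ⇒
uniformly continuous ⇒ `→ 0`).  Stated minimally: SOME `C¹` potential `q` with the drop identity (slope constant `m ∈ ℝ`) decaying at
infinity.  Why it might fail: the pressure representation must be the MILD one (a parasitic `∇h(t)` would break decay) — exactly what the
Oseen gauge in K2's conclusion provides; Lean size L. -/
def T3 : Prop :=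
  ∀ (W : ℝ → EuclideanSpace ℝ (Fin 3) → EuclideanSpace ℝ (Fin 3)), (Literature.Analysis.FluidPDE.IsKNSSBlowupLimit W ∧ (∀ s t : ℝ, s < t → t < 0 → ∀ x, W t x = Literature.Analysis.FluidPDE.heatFlow (W s) (t - s) x - Literature.Analysis.FluidPDE.oseenDuhamel 1 s W W t x)) → ∀ (t₀ : ℝ) (M : ℝ → ℝ) (s : ℕ → ℝ), t₀ < 0 →
      (∀ n, s n ≠ t₀ ∧ s n < 0 ∧ ∀ x, ‖W (s n) x‖ = M (s n)) → Tendsto s atTop (𝓝 t₀) →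
      (∀ x, ‖W t₀ x‖ = M t₀) →
      (∫⁻ x, ‖iteratedFDeriv ℝ 1 (W t₀) x‖ₑ ^ 2 < ⊤) →
      ∃ (q : EuclideanSpace ℝ (Fin 3) → ℝ) (m : ℝ), ContDiff ℝ 1 q ∧
        (∀ x, fderiv ℝ q x (W t₀ x) = -(Literature.Analysis.FluidPDE.frobeniusNormSq (fderiv ℝ (W t₀) x)) - m) ∧
        Tendsto q (cocompact (EuclideanSpace ℝ (Fin 3))) (𝓝 0)

/-- T4 (`bernoulliLiouville` — PROVED in REV 1.5; THE LEVER, pure analysis, no PDE): BERNOULLI–LIOUVILLE FOR CONSTANT-SPEED FIELDS.  A `C²` field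
`V` of constant speed `M > 0` with bounded derivative, far-field drift `V → c` and `DV → 0` at infinity, carrying a `C¹` potential `q → 0`
at infinity whose derivative ALONG THE FIELD is `−|DV|²_F − m` (constant `m`), is FLAT on a nonempty open set.  Proof sketch: far off the
drift axis every streamline `γ′ = V(γ)` (global: `V` Lipschitz) escapes to infinity in both time directions without entering the core ball,
by BOUNDED CROSSING TIME (REV 1.1, idea-crit-8 V95 P2 — no decay rate is needed): `|c| = M`; `K = {|V − c| > M/2} ⊆ B_R` since `V → c`;
start at `x₀` beside the core (axial coordinate `0` along `c`, distance `r₀ > 3R` from the axis); while `γ ∉ B_R` the axial speed is `≥ M/2`,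
so the axial coordinate reaches `R` within time `2R/M`, during which the displacement is `≤ 2R < r₀ − R` — hence `γ` never met `B_R`
(bootstrap) and afterwards `|γ(s)| ≥` its axial coordinate `↑ +∞`; the same backwards.  Then `g(s) = q(γ(s))` has `g′ = −|DV(γ)|²_F − m`,
`g(±∞) = 0` and `g′(s) → −m`, so `m = 0`, then `g` is monotone with equal limits, so `|DV(γ(s))| ≡ 0`: `DV = 0` on the open set
`{axial coordinate near 0, axis distance > 3R}`.  Why it might fail: it does not — PROVED in REV 1.5 (`T4Proof.*`, ≈ 330 lines: global
flow `lipschitzFlow`, `HasDerivAt` of `q ∘ γ`, limits). -/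
def T4 : Prop :=
  ∀ (V : EuclideanSpace ℝ (Fin 3) → EuclideanSpace ℝ (Fin 3)) (q : EuclideanSpace ℝ (Fin 3) → ℝ) (c : EuclideanSpace ℝ (Fin 3)) (M m B : ℝ),
      ContDiff ℝ 2 V → ContDiff ℝ 1 q → 0 < M → (∀ x, ‖V x‖ = M) → (∀ x, ‖fderiv ℝ V x‖ ≤ B) →
      (∀ x, fderiv ℝ q x (V x) = -(Literature.Analysis.FluidPDE.frobeniusNormSq (fderiv ℝ V x)) - m) →
      Tendsto q (cocompact (EuclideanSpace ℝ (Fin 3))) (𝓝 0) → Tendsto V (cocompact (EuclideanSpace ℝ (Fin 3))) (𝓝 c) →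
      Tendsto (fun x => fderiv ℝ V x) (cocompact (EuclideanSpace ℝ (Fin 3))) (𝓝 0) →
      ∃ U : Set (EuclideanSpace ℝ (Fin 3)), IsOpen U ∧ U.Nonempty ∧ ∀ x ∈ U, fderiv ℝ V x = 0

end Sig

/-! ## Line B's stubs K2, K1a (restated verbatim — SHARED with `Lines/extremiser_liouville.lean` and `Lines/l2_budget.lean`) -/

/-- **K2 · stub_extremalPersistenceCompactness (crux of the line, XL; the load-bearing stub).**  PERSISTENCE COMPACTIFIES:
if near-extremal stretching persists in windowed log-time mean at levels β ↑ κ⋆² on windows of unbounded log-length along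
Type-I singular flows (the scenario P of the module docstring), then an extremal ancient solution exists (module docstring).
Mechanism (card §Stubs): choose β_n ↑ κ⋆², L_n ↑ ∞, flows u_n and windows; centre at an efficient time t_n near the argmax of
the Leray number m(t) = ‖u(t)‖∞√(T−t)/√ν over the window (so the KNSS-rescaled flow is bounded by 2 backward, whatever the
Type-I constant C_n), at a point of the heavy near-extremal piece; SCALE LOCK: in a near-extremal window with the enstrophy
keeping Leray's pace, the dissipation length ℓ = √(Z/P) is comparable to the parabolic length √(ν(T−t)) on a set of times of
positive log-density (d log Z/ds ≤ 2κ⋆m/ℓ̃ − 2/ℓ̃², ℓ̃ = ℓ/√(ν(T−t)), forces ℓ̃ ∈ [2κ⋆m ∓ 2√(κ⋆²m²−1)] where Z grows), so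
the rescaled viscosity stays 1 and the efficient structure lives at the parabolic scale; KNSS C^∞_loc compactness of bounded
Oseen-mild sequences (tree `isKNSSBlowupLimit_of_oseenMild_zoom`, `KNSS2009_lemma61_*`) gives the limit W in the Oseen
gauge; TIGHTNESS of near-maximisers of R (splitting far-apart pieces is R-neutral only at equal amplitude and equal Z/P
ratio — Cauchy–Schwarz — so every heavy piece of a near-extremal field is near-extremal) and Fatou on the followed piece give
extremal slices for a.e. time of an interval around the centring time.
Why it might fail: loss of tightness (the efficient structure at time t and at time t' are different structures escaping to
infinity from each other in rescaled units — then only one instant survives); or the followed piece loses finite (Z,P) in the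
limit (enstrophy spread over ≫ parabolic scales); or near-extremal windows realise their mean by SHORT bursts at scales
≪ parabolic (ℓ̃ → 0 on the efficient set, Euler scaling) — the scale-lock inequality bounds this only where Z grows. -/
theorem stub_extremalPersistenceCompactness :
    (∀ β : ℝ, β < (sInf {κ : ℝ | (∀ (v : EuclideanSpace ℝ (Fin 3) → EuclideanSpace ℝ (Fin 3)) (M B : ℝ), ContDiff ℝ (⊤ : ℕ∞) v → Literature.Analysis.FluidPDE.VectorCalculus.IsDivFree v → (∀ x, ‖v x‖ ≤ M) → (∀ x, ‖fderiv ℝ v x‖ ≤ B) → (∫⁻ x, ‖iteratedFDeriv ℝ 0 v x‖ₑ ^ 2 < ⊤) → (∫⁻ x, ‖iteratedFDeriv ℝ 1 v x‖ₑ ^ 2 < ⊤) → (∫⁻ x, ‖iteratedFDeriv ℝ 2 v x‖ₑ ^ 2 < ⊤) → |∫ x, ⟪Literature.Analysis.FluidPDE.curl v x, fderiv ℝ v x (Literature.Analysis.FluidPDE.curl v x)⟫_ℝ| ≤ κ * M * Real.sqrt (∫ x, ‖Literature.Analysis.FluidPDE.curl v x‖ ^ 2) * Real.sqrt (∫ x,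 Literature.Analysis.FluidPDE.frobeniusNormSq (fderiv ℝ (Literature.Analysis.FluidPDE.curl v) x)))}) ^ 2 → ∀ L : ℝ, 0 < L → ∃ (C ν T : ℝ) (u : ℝ → EuclideanSpace ℝ (Fin 3) → EuclideanSpace ℝ (Fin 3)) (p : ℝ → EuclideanSpace ℝ (Fin 3) → ℝ), 0 < C ∧ 0 < ν ∧ 0 < T ∧ Literature.Analysis.FluidPDE.IsClassicalNSSolutionOn (Set.Ico 0 T) ν 0 u p ∧ Literature.Analysis.FluidPDE.IsLerayHopfOn T ν 0 (u 0) u ∧ Literature.Analysis.FluidPDE.HasRapidSpatialDecay (u 0) ∧ (∀ᶠ t in 𝓝[<] T, ∀ x, Real.sqrt (T - t) * ‖u t x‖ ≤ C * Real.sqrt ν) ∧ ¬ Literature.Analysis.FluidPDE.HasSmoothExtensionPast ν 0 u T ∧ ∀ (k : ℝ → ℝ), Measurable k → (∀ τ, 0 ≤ k τ ∧ k τ ≤ 1) → (∀ t ∈ Set.Ico 0 T, ∀ M : ℝ, (∀ x, ‖u t x‖ ≤ M) → |∫ x, ⟪Literature.Analysis.FluidPDE.curl (u t) x, fderiv ℝ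 (u t) x (Literature.Analysis.FluidPDE.curl (u t) x)⟫_ℝ| ≤ k t * M * Real.sqrt (∫ x, ‖Literature.Analysis.FluidPDE.curl (u t) x‖ ^ 2) * Real.sqrt (∫ x, Literature.Analysis.FluidPDE.frobeniusNormSq (fderiv ℝ (Literature.Analysis.FluidPDE.curl (u t)) x))) → ∀ t₁ ∈ Set.Ico 0 T, ∃ s₁ s₂ : ℝ, t₁ ≤ s₁ ∧ s₁ < s₂ ∧ s₂ < T ∧ L ≤ Real.log ((T - s₁) / (T - s₂)) ∧ β * Real.log ((T - s₁) / (T - s₂)) < ∫ τ in s₁..s₂, k τ ^ 2 / (T - τ)) → ∃ (W : ℝ → EuclideanSpace ℝ (Fin 3) → EuclideanSpace ℝ (Fin 3)) (a b : ℝ), (Literature.Analysis.FluidPDE.IsKNSSBlowupLimit W ∧ (∀ s t : ℝ, s < t → t < 0 → ∀ x, W t x = Literature.Analysis.FluidPDE.heatFlow (W s) (t - s) x - Literature.Analysis.FluidPDE.oseenDuhamel 1 s W W t x)) ∧ a < b ∧ b ≤ 0 ∧ ∀ᵐ t : ℝ, t ∈ Set.Ioo a b → (ContDiff ℝ (⊤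 : ℕ∞) (W t) ∧ Literature.Analysis.FluidPDE.VectorCalculus.IsDivFree (W t) ∧ (∃ B : ℝ, ∀ x, ‖fderiv ℝ (W t) x‖ ≤ B) ∧ (∫⁻ x, ‖iteratedFDeriv ℝ 1 (W t) x‖ₑ ^ 2 < ⊤) ∧ (∫⁻ x, ‖iteratedFDeriv ℝ 2 (W t) x‖ₑ ^ 2 < ⊤) ∧ ∃ M : ℝ, (∀ x, ‖(W t) x‖ ≤ M) ∧ 0 < M * Real.sqrt (∫ x, ‖Literature.Analysis.FluidPDE.curl (W t) x‖ ^ 2) * Real.sqrt (∫ x, Literature.Analysis.FluidPDE.frobeniusNormSq (fderiv ℝ (Literature.Analysis.FluidPDE.curl (W t)) x)) ∧ (sInf {κ : ℝ | (∀ (v : EuclideanSpace ℝ (Fin 3) → EuclideanSpace ℝ (Fin 3)) (M B : ℝ), ContDiff ℝ (⊤ : ℕ∞) v → Literature.Analysis.FluidPDE.VectorCalculus.IsDivFree v → (∀ x, ‖v x‖ ≤ M) → (∀ x, ‖fderiv ℝ v x‖ ≤ B) → (∫⁻ x, ‖iteratedFDeriv ℝ 0 v x‖ₑ ^ 2 <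 ⊤) → (∫⁻ x, ‖iteratedFDeriv ℝ 1 v x‖ₑ ^ 2 < ⊤) → (∫⁻ x, ‖iteratedFDeriv ℝ 2 v x‖ₑ ^ 2 < ⊤) → |∫ x, ⟪Literature.Analysis.FluidPDE.curl v x, fderiv ℝ v x (Literature.Analysis.FluidPDE.curl v x)⟫_ℝ| ≤ κ * M * Real.sqrt (∫ x, ‖Literature.Analysis.FluidPDE.curl v x‖ ^ 2) * Real.sqrt (∫ x, Literature.Analysis.FluidPDE.frobeniusNormSq (fderiv ℝ (Literature.Analysis.FluidPDE.curl v) x)))}) * M * Real.sqrt (∫ x, ‖Literature.Analysis.FluidPDE.curl (W t) x‖ ^ 2) * Real.sqrt (∫ x, Literature.Analysis.FluidPDE.frobeniusNormSq (fderiv ℝ (Literature.Analysis.FluidPDE.curl (W t)) x)) ≤ |∫ x, ⟪Literature.Analysis.FluidPDE.curl (W t) x, fderiv ℝ (W t) x (Literature.Analysis.FluidPDE.curl (W t) x)⟫_ℝ|) := by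
  sorry

section K1aProof
open Literature.Analysis Literature.Analysis.FluidPDE Literature.Analysis.FluidPDE.LocalTypeIBlowup TopologicalSpace

/-- **K1a · analyticSlices — PROVED (REV 1.3).**  Slices of a KNSS blow-up limit in the Oseen gauge are REAL-ANALYTIC in
space at every negative time.  Proof = the tree's `IsTypeIAncientMild.analyticOnNhd_slice_univ` (Barker–Prange port) transposed
to the bounded class `|W| ≤ 1`: Lemarié-Rieusset 2016 Thm 9.12 in the proved local form `lemarieRieusset2016_local_analyticity_holds`
(the Oseen fixed point from the bounded datum `W s₁` is jointly real-analytic on its window `ε/M²`, `M = 2`), identified with `W` on the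
window by `oseenMild_bounded_unique` (the Oseen-gauge representation in K2's conclusion is exactly its hypothesis), then
`analyticOnNhd_slice`.  Formerly the shared stub `stub_analyticSlices` of line B / l2_budget / bernoulli_liouville / record_instant. -/
theorem analyticSlices : Sig.K1A := by
  intro W hWp t ht
  obtain ⟨hW, hrep⟩ := hWp
  obtain ⟨ε, hε, C₀, hC₀, hloc⟩ := lemarieRieusset2016_local_analyticity_holds
  have hsm : ContDiffOn ℝ (⊤ : ℕ∞) (uncurry W) (Iio 0 ×ˢ univ) := hW.smooth
  have hslice : ∀ τ : ℝ, τ < 0 → ContDiff ℝ (⊤ : ℕ∞) (W τ) := fun τ hτ =>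
    hsm.comp_contDiff (contDiff_prodMk_right τ) fun x => mk_mem_prod (mem_Iio.2 hτ) (mem_univ x)
  have hcont : ∀ τ : ℝ, τ < 0 → Continuous (W τ) := fun τ hτ => (hslice τ hτ).continuous
  -- uniform bound `1` and the window data
  set Mb : ℝ := (1 : ℝ) + 1 with hMb
  have hMb0 : 0 < Mb := by rw [hMb]; norm_num
  have hlen : 0 < ε * 1 / Mb ^ 2 := by positivity
  set s₁ : ℝ := t - (ε * 1 / Mb ^ 2) / 2 with hs₁
  have hs₁t : s₁ < t := by rw [hs₁]; linarith
  have hs₁0 : s₁ < 0 := by linarith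
  have ha_meas : AEStronglyMeasurable (W s₁) volume := (hcont s₁ hs₁0).aestronglyMeasurable
  have ha_bd : eLpNorm (W s₁) ∞ volume ≤ ENNReal.ofReal Mb := by
    rw [eLpNorm_exponent_top]
    refine eLpNormEssSup_le_of_ae_bound (Eventually.of_forall fun x => ?_)
    exact (hW.norm_le_one s₁ hs₁0 x).trans (by rw [hMb]; norm_num)
  obtain ⟨vl, hvl_an, hvl_eq, hvl_bd⟩ := hloc one_pos s₁ hMb0 ha_meas ha_bd
  -- the common window `(s₁, T₂)`, `T₂ = min (s₁ + ε/Mb²) (t/2) ∋ t`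
  set T₂ : ℝ := min (s₁ + ε * 1 / Mb ^ 2) (t / 2) with hT₂
  have htT₂ : t < T₂ := lt_min (by rw [hs₁]; linarith) (by linarith)
  have hT₂0 : T₂ < 0 := (min_le_right _ _).trans_lt (by linarith)
  have hT₂h : T₂ ≤ s₁ + ε * 1 / Mb ^ 2 := min_le_left _ _
  -- uniqueness of bounded Oseen-mild solutions on the window
  set M' : ℝ := max 1 (C₀ * Mb) with hM'
  have hM'0 : 0 ≤ M' := zero_le_one.trans (le_max_left _ _)
  have hum : AEStronglyMeasurable (uncurry W) (volume.restrict (Ioo s₁ T₂ ×ˢ univ)) :=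
    (hsm.continuousOn.mono (prod_mono (fun τ hτ => mem_Iio.2 ((mem_Ioo.1 hτ).2.trans hT₂0))
      Subset.rfl)).aestronglyMeasurable (measurableSet_Ioo.prod MeasurableSet.univ)
  have hvm : AEStronglyMeasurable (uncurry vl) (volume.restrict (Ioo s₁ T₂ ×ˢ univ)) :=
    (hvl_an.continuousOn.mono (prod_mono (Ioo_subset_Ioo_right hT₂h) Subset.rfl)).aestronglyMeasurable
      (measurableSet_Ioo.prod MeasurableSet.univ)
  have huM : ∀ τ ∈ Ioo s₁ T₂, ∀ y, ‖W τ y‖ ≤ M' := fun τ hτ y =>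
    (hW.norm_le_one τ (hτ.2.trans hT₂0) y).trans (le_max_left _ _)
  have hvM : ∀ τ ∈ Ioo s₁ T₂, ∀ y, ‖vl τ y‖ ≤ M' := fun τ hτ y =>
    (hvl_bd τ ⟨hτ.1, hτ.2.trans_le hT₂h⟩ y).trans (le_max_right _ _)
  have hu : ∀ τ ∈ Ioo s₁ T₂, W τ =ᵐ[volume] fun x =>
      UnboundedOperators.heatExtension (W s₁) (1 * (τ - s₁)) x - oseenDuhamel 1 s₁ W W τ x :=
    fun τ hτ => Eventually.of_forall fun x => by
      rw [one_mul, hrep s₁ τ hτ.1 (hτ.2.trans hT₂0) x, heatFlow_of_pos _ (sub_pos.2 hτ.1)]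
  have hv : ∀ τ ∈ Ioo s₁ T₂, vl τ =ᵐ[volume] fun x =>
      UnboundedOperators.heatExtension (W s₁) (1 * (τ - s₁)) x - oseenDuhamel 1 s₁ vl vl τ x :=
    fun τ hτ => Eventually.of_forall fun x => hvl_eq τ ⟨hτ.1, hτ.2.trans_le hT₂h⟩ x
  have heq := oseenMild_bounded_unique
    (U := fun τ x => UnboundedOperators.heatExtension (W s₁) (1 * (τ - s₁)) x)
    one_pos hM'0 hum hvm huM hvM hu hv t ⟨hs₁t, htT₂⟩
  have htwin : t ∈ Ioo s₁ (s₁ + ε * 1 / Mb ^ 2) := ⟨hs₁t, htT₂.trans_le hT₂h⟩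
  have hvlt : AnalyticOnNhd ℝ (vl t) univ := analyticOnNhd_slice hvl_an htwin
  have hUt : W t = vl t :=
    (Continuous.ae_eq_iff_eq volume (hcont t ht) (continuousOn_univ.1 hvlt.continuousOn)).1 heq
  rw [hUt]
  exact hvlt

end K1aProof

/-! ## T1 PROVED (REV 1.2): constant speed at an extremal time where extremal times accumulate -/

/-- Extremal finite-budget slice data at time `t` (the a.e.-clause of `Sig.T1`, verbatim; helper for the T1 proof). -/
def SLICE (W : ℝ → EuclideanSpace ℝ (Fin 3) → EuclideanSpace ℝ (Fin 3)) (t : ℝ) : Prop :=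
  (ContDiff ℝ (⊤ : ℕ∞) (W t) ∧ Literature.Analysis.FluidPDE.VectorCalculus.IsDivFree (W t) ∧ (∃ B : ℝ, ∀ x, ‖fderiv ℝ (W t) x‖ ≤ B) ∧ (∫⁻ x, ‖iteratedFDeriv ℝ 1 (W t) x‖ₑ ^ 2 < ⊤) ∧ (∫⁻ x, ‖iteratedFDeriv ℝ 2 (W t) x‖ₑ ^ 2 < ⊤) ∧ ∃ M : ℝ, (∀ x, ‖(W t) x‖ ≤ M) ∧ 0 < M * Real.sqrt (∫ x, ‖Literature.Analysis.FluidPDE.curl (W t) x‖ ^ 2) * Real.sqrt (∫ x, Literature.Analysis.FluidPDE.frobeniusNormSq (fderiv ℝ (Literature.Analysis.FluidPDE.curl (W t)) x)) ∧ (sInf {κ : ℝ | (∀ (v : EuclideanSpace ℝ (Fin 3) → EuclideanSpace ℝ (Fin 3)) (M B : ℝ), ContDiff ℝ (⊤ : ℕ∞) v → Literature.Analysis.FluidPDE.VectorCalculus.IsDivFree v → (∀ x, ‖v x‖ ≤ M) → (∀ x, ‖fderiv ℝ v x‖ ≤ B) → (∫⁻ x, ‖iteratedFDeriv ℝ 0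 v x‖ₑ ^ 2 < ⊤) → (∫⁻ x, ‖iteratedFDeriv ℝ 1 v x‖ₑ ^ 2 < ⊤) → (∫⁻ x, ‖iteratedFDeriv ℝ 2 v x‖ₑ ^ 2 < ⊤) → |∫ x, ⟪Literature.Analysis.FluidPDE.curl v x, fderiv ℝ v x (Literature.Analysis.FluidPDE.curl v x)⟫_ℝ| ≤ κ * M * Real.sqrt (∫ x, ‖Literature.Analysis.FluidPDE.curl v x‖ ^ 2) * Real.sqrt (∫ x, Literature.Analysis.FluidPDE.frobeniusNormSq (fderiv ℝ (Literature.Analysis.FluidPDE.curl v) x)))}) * M * Real.sqrt (∫ x, ‖Literature.Analysis.FluidPDE.curl (W t) x‖ ^ 2) * Real.sqrt (∫ x, Literature.Analysis.FluidPDE.frobeniusNormSq (fderiv ℝ (Literature.Analysis.FluidPDE.curl (W t)) x)) ≤ |∫ x, ⟪Literature.Analysis.FluidPDE.curl (W t) x, fderiv ℝ (W t) x (Literature.Analysis.FluidPDE.curl (W t) x)⟫_ℝ|)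

/-! The T1 proof: each extremal analytic slice has constant speed (equality in `extendedSharp` + the landed
`ExtremiserLiouville.norm_eq_of_analytic_extremal`; `0 < M`, `DW ≢ 0` from `0 < M‖ω‖₂‖∇ω‖₂` via `norm_curl_le`), and an a.e.-in-`(a,b)`
property holds somewhere in every non-trivial sub-interval (`Real.volume_Ioo`), which yields an extremal `t₀` and extremal `s n ↑ t₀`. -/

/-- one extremal analytic slice: constant speed and the slice data (the T1ʳ argument of LINE g8-2). -/
theorem slice_constSpeed {W : ℝ → EuclideanSpace ℝ (Fin 3) → EuclideanSpace ℝ (Fin 3)} {t : ℝ}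
    (hs : SLICE W t) (han : AnalyticOnNhd ℝ (W t) Set.univ) :
    (∀ x, ‖W t x‖ = ‖W t 0‖) ∧ 0 < ‖W t 0‖ ∧ ContDiff ℝ 2 (W t) ∧
      (∃ B : ℝ, ∀ x, ‖fderiv ℝ (W t) x‖ ≤ B) ∧ (∫⁻ x, ‖iteratedFDeriv ℝ 1 (W t) x‖ₑ ^ 2 < ⊤) ∧
      (∃ x, fderiv ℝ (W t) x ≠ 0) := by
  obtain ⟨hcd, hdiv, ⟨B, hB⟩, h1, h2, M, hM, hpos, hge⟩ := hs
  have hle := Summit.NavierStokesRegularity.NavierStokesRegularity.Theorems.ExtremiserLiouville.extendedSharp (W t) M B hcd hdiv hM hB h1 h2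
  have heq := le_antisymm hge hle
  have hcs : ∀ x, ‖W t x‖ = M :=
    Summit.NavierStokesRegularity.NavierStokesRegularity.Theorems.ExtremiserLiouville.norm_eq_of_analytic_extremal
      hcd han hdiv hM hB h1 h2 hpos heq.symm
  have hZ0 : 0 ≤ Real.sqrt (∫ x, ‖Literature.Analysis.FluidPDE.curl (W t) x‖ ^ 2) := Real.sqrt_nonneg _
  have hW0 : 0 ≤ Real.sqrt (∫ x, Literature.Analysis.FluidPDE.frobeniusNormSq (fderiv ℝ (Literature.Analysis.FluidPDE.curl (W t)) x)) :=
    Real.sqrt_nonneg _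
  have hMpos : 0 < M := by
    by_contra hle0
    push Not at hle0
    have : M * Real.sqrt (∫ x, ‖Literature.Analysis.FluidPDE.curl (W t) x‖ ^ 2) *
        Real.sqrt (∫ x, Literature.Analysis.FluidPDE.frobeniusNormSq (fderiv ℝ (Literature.Analysis.FluidPDE.curl (W t)) x)) ≤ 0 :=
      mul_nonpos_of_nonpos_of_nonneg (mul_nonpos_of_nonpos_of_nonneg hle0 hZ0) hW0
    linarith
  have hC2 : ContDiff ℝ 2 (W t) := hcd.of_le (by decide)
  have hDne : ∃ x, fderiv ℝ (W t) x ≠ 0 := by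
    by_contra hall
    push Not at hall
    have hcurl0 : ∀ x, Literature.Analysis.FluidPDE.curl (W t) x = 0 := by
      intro x
      have h := Literature.Analysis.FluidPDE.norm_curl_le (W t) x
      rw [hall x, norm_zero, mul_zero] at h
      exact norm_le_zero_iff.1 h
    have hint : (∫ x, ‖Literature.Analysis.FluidPDE.curl (W t) x‖ ^ 2) = 0 := by
      simp [hcurl0]
    rw [hint, Real.sqrt_zero, mul_zero, zero_mul] at hpos
    exact lt_irrefl _ hpos
  have hM0 : ‖W t 0‖ = M := hcs 0
  refine ⟨fun x => by rw [hcs x, hM0], by rw [hM0]; exact hMpos, hC2, ⟨B, hB⟩, h1, hDne⟩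

/-- a.e. on an interval ⇒ somewhere on every non-trivial sub-interval. -/
theorem exists_mem_Ioo_of_ae {P : ℝ → Prop} {a b : ℝ} (hae : ∀ᵐ t : ℝ, t ∈ Set.Ioo a b → P t)
    {c d : ℝ} (hcd : c < d) (hac : a ≤ c) (hdb : d ≤ b) : ∃ t ∈ Set.Ioo c d, P t := by
  by_contra hno
  push Not at hno
  have hnull : volume {t : ℝ | ¬ (t ∈ Set.Ioo a b → P t)} = 0 := ae_iff.1 hae
  have hsub : Set.Ioo c d ⊆ {t : ℝ | ¬ (t ∈ Set.Ioo a b → P t)} := by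
    intro t ht h
    exact hno t ht (h ⟨lt_of_le_of_lt hac ht.1, lt_of_lt_of_le ht.2 hdb⟩)
  have hle : volume (Set.Ioo c d) ≤ 0 := (measure_mono hsub).trans hnull.le
  have hvol : volume (Set.Ioo c d) = ENNReal.ofReal (d - c) := Real.volume_Ioo
  rw [hvol] at hle
  have : ENNReal.ofReal (d - c) = 0 := le_antisymm hle bot_le
  rw [ENNReal.ofReal_eq_zero] at this
  linarith

theorem constSpeedAccumulation : Sig.T1 := by
  intro W a b hW hab hb0 hae han
  -- an extremal time `t₀ ∈ (a,b)`
  obtain ⟨t₀, ht₀, hs₀⟩ := exists_mem_Ioo_of_ae (P := SLICE W) hae hab le_rfl le_rfl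
  -- extremal times to the left of `t₀`, closer than `1/(n+1)`
  have hleft : ∀ n : ℕ, ∃ t ∈ Set.Ioo (max a (t₀ - 1 / ((n : ℝ) + 1))) t₀, SLICE W t := by
    intro n
    have hn : (0 : ℝ) < 1 / ((n : ℝ) + 1) := by positivity
    exact exists_mem_Ioo_of_ae (P := SLICE W) hae (max_lt ht₀.1 (by linarith)) (le_max_left _ _) ht₀.2.le
  choose s hs hsl using hleft
  refine ⟨t₀, fun t => ‖W t 0‖, s, ht₀.1, ht₀.2, ?_, ?_, ?_⟩
  · intro n
    have hsn := hs n
    have hlt : s n < t₀ := hsn.2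
    refine ⟨hlt.ne, by linarith [ht₀.2], ?_⟩
    exact (slice_constSpeed (hsl n) (han (s n) (by linarith [ht₀.2]))).1
  · -- squeeze: t₀ - 1/(n+1) < s n < t₀
    have hlow : Tendsto (fun n : ℕ => t₀ - 1 / ((n : ℝ) + 1)) atTop (𝓝 t₀) := by
      have h : Tendsto (fun n : ℕ => 1 / ((n : ℝ) + 1)) atTop (𝓝 0) := tendsto_one_div_add_atTop_nhds_zero_nat
      have h2 := (tendsto_const_nhds (x := t₀) (f := (atTop : Filter ℕ))).sub h
      simpa using h2
    refine tendsto_of_tendsto_of_tendsto_of_le_of_le hlow tendsto_const_nhds (fun n => ?_) (fun n => (hs n).2.le)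
    exact ((le_max_right _ _).trans_lt (hs n).1).le
  · obtain ⟨hcs, hpos, hC2, hBex, h1, hDne⟩ := slice_constSpeed hs₀ (han t₀ (lt_of_lt_of_le ht₀.2 hb0))
    exact ⟨hcs, hpos, hC2, hBex, h1, hDne⟩

/-! ## The three remaining new stubs -/

/-- **T2b · stub_farFieldGradient** (M; the OPEN remainder of T2 since REV 1.4 — see `Sig.T2b`). -/
theorem stub_farFieldGradient : Sig.T2b := by
  sorry

section T2aProof
open Literature.Analysis Literature.Analysis.FluidPDE TopologicalSpace

/-- **KNSS gradient bound on slices — PROVED.**  Every negative-time slice of a KNSS blow-up limit in the Oseen gauge has BOUNDED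
GRADIENT: KNSS 2009 (4.6) with `k = 1` in the tree's proved form `IsKNSSDriftMild.exists_gradient_bound`, applied to the clamped,
time-shifted window field `V t := W (t₀ − 1 + clamp t)` (drift `b = 0`, `N = 1`), which is `IsKNSSDriftMild` because the Oseen-gauge
representation is `driftDuhamel_zero_eq_oseenDuhamel` + `oseenDuhamel_translate` away from the drift-mild identity.  (Consequence for
K2's prover: the clause `∃ B, ∀ x, ‖fderiv ℝ (W t) x‖ ≤ B` of K2's slice data is AUTOMATIC for KNSS limits.) -/
theorem knss_fderiv_bounded (W : ℝ → EuclideanSpace ℝ (Fin 3) → EuclideanSpace ℝ (Fin 3)) (hW : IsKNSSBlowupLimit W)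
    (hrep : ∀ s t : ℝ, s < t → t < 0 → ∀ x, W t x = heatFlow (W s) (t - s) x - oseenDuhamel 1 s W W t x)
    (t₀ : ℝ) (ht₀ : t₀ < 0) : ∃ B : ℝ, ∀ x, ‖fderiv ℝ (W t₀) x‖ ≤ B := by
  obtain ⟨C, hC0, hC⟩ := IsKNSSDriftMild.exists_gradient_bound (E := EuclideanSpace ℝ (Fin 3)) finrank_euclideanSpace_fin
  have hsm : ContDiffOn ℝ (⊤ : ℕ∞) (uncurry W) (Iio 0 ×ˢ univ) := hW.smooth
  have hslice : ∀ τ : ℝ, τ < 0 → ContDiff ℝ (⊤ : ℕ∞) (W τ) := fun τ hτ =>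
    hsm.comp_contDiff (contDiff_prodMk_right τ) fun x => mk_mem_prod (mem_Iio.2 hτ) (mem_univ x)
  -- the window: `a = t₀ − 1`, length `T = 1 − t₀/2 > 1`, `a + T = t₀/2 < 0`
  set a : ℝ := t₀ - 1 with ha
  set T : ℝ := 1 - t₀ / 2 with hT
  have hT1 : 1 < T := by rw [hT]; linarith
  have hT0 : 0 ≤ T := by linarith
  set κ : ℝ → ℝ := fun t => a + max 0 (min t T) with hκ
  have hκle : ∀ t, κ t < 0 := by
    intro t
    have h1 : max 0 (min t T) ≤ T := max_le hT0 (min_le_right _ _)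
    have : κ t ≤ a + T := by simp only [hκ]; linarith
    have haT : a + T = t₀ / 2 := by rw [ha, hT]; ring
    linarith
  have hκid : ∀ t, 0 ≤ t → t ≤ T → κ t = a + t := by
    intro t h0 h1
    simp only [hκ, min_eq_left h1, max_eq_right h0]
  have hκc : Continuous κ := continuous_const.add (continuous_const.max (continuous_id.min continuous_const))
  set V : ℝ → EuclideanSpace ℝ (Fin 3) → EuclideanSpace ℝ (Fin 3) := fun t x => W (κ t) x with hV
  have hVcont : Continuous (uncurry V) := by
    have hmap : Continuous fun p : ℝ × EuclideanSpace ℝ (Fin 3) => (κ p.1, p.2) :=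
      (hκc.comp continuous_fst).prodMk continuous_snd
    have hinto : ∀ p : ℝ × EuclideanSpace ℝ (Fin 3), (κ p.1, p.2) ∈ Iio 0 ×ˢ (univ : Set (EuclideanSpace ℝ (Fin 3))) :=
      fun p => ⟨hκle p.1, mem_univ _⟩
    exact (hsm.continuousOn.comp_continuous hmap hinto).congr fun p => rfl
  have hVslice : ∀ t, Continuous (V t) := fun t => (hslice (κ t) (hκle t)).continuous
  have hVnorm : ∀ t x, ‖V t x‖ ≤ 1 := fun t x => hW.norm_le_one (κ t) (hκle t) x
  have hVmild : IsKNSSDriftMild T 1 V 0 := by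
    refine IsKNSSDriftMild.mk measurable_const (fun t => by simp) hVcont.measurable
      (fun t _ x => hVnorm t x) (Eventually.of_forall fun t => hW.isBoundedAncientMildSolution.1.1 (κ t) (hκle t)) ?_
    intro s t hs hst htT x
    have hs' : κ s = a + s := hκid s hs.le (hst.le.trans htT.le)
    have ht' : κ t = a + t := hκid t (hs.le.trans hst.le) htT.le
    have hVm : ∀ σ ∈ Ioo s t, Measurable (V σ) := fun σ _ => (hVslice σ).measurable
    have hVN : ∀ σ ∈ Ioo s t, ∀ y, ‖V σ y‖ ≤ 1 := fun σ _ y => hVnorm σ y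
    rw [driftDuhamel_zero_eq_oseenDuhamel finrank_euclideanSpace_fin hVm hVN hst.le x]
    have hcongr : ∀ τ ∈ Ioo s t, V τ = (fun r => W (r + a)) τ := fun τ hτ => by
      funext y
      show W (κ τ) y = W (τ + a) y
      rw [hκid τ (hs.le.trans hτ.1.le) (hτ.2.le.trans htT.le), add_comm]
    rw [oseenDuhamel_congr_Ioo hcongr hcongr x, oseenDuhamel_translate]
    show W (κ t) x = UnboundedOperators.heatExtension (W (κ s)) (t - s) x - oseenDuhamel 1 (s + a) W W (t + a) x
    rw [ht', hs']
    have hlt : a + s < a + t := by linarith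
    have hneg : a + t < 0 := by have := hκle t; rwa [ht'] at this
    have key := hrep (a + s) (a + t) hlt hneg x
    rw [heatFlow_of_pos _ (by linarith : (0 : ℝ) < a + t - (a + s))] at key
    rw [key, add_comm s a, add_comm t a]
    congr 2
    ring
  -- the gradient bound at `t = 1` (`V 1 = W t₀`), from `s = 1/2`
  have hwin : (1 : ℝ) ^ 2 * (1 - 1 / 2) ≤ 1 := by norm_num
  have hV1 : V 1 = W t₀ := by
    funext y
    show W (κ 1) y = W t₀ y
    rw [hκid 1 zero_le_one hT1.le, ha]
    ring_nf
  set r : ℝ := ((1 : ℝ) - 1 / 2) ^ (1 / 2 : ℝ) with hr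
  have hrpos : 0 < r := Real.rpow_pos_of_pos (by norm_num) _
  refine ⟨C / r, fun x => ?_⟩
  have h := hC hVmild (s := 1 / 2) (t := 1) (by norm_num) (by norm_num) hT1 hwin x
  rw [hV1] at h
  rw [le_div_iff₀ hrpos, mul_comm]
  simpa [hr] using h

/-- **T2 part (a) — PROVED.**  The far-field VALUE `c` of a slice `W(t₀)` with `DW(t₀) ∈ L²` exists (`W(t₀,x) → c` along `cocompact`):
`knss_fderiv_bounded` supplies the gradient bound that the tree's `ExtremiserLiouville.exists_farFieldLimit` (Galdi II.6.1) needs. -/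
theorem farFieldValue (W : ℝ → EuclideanSpace ℝ (Fin 3) → EuclideanSpace ℝ (Fin 3)) (hW : IsKNSSBlowupLimit W)
    (hrep : ∀ s t : ℝ, s < t → t < 0 → ∀ x, W t x = heatFlow (W s) (t - s) x - oseenDuhamel 1 s W W t x)
    (t₀ : ℝ) (ht₀ : t₀ < 0) (h1 : ∫⁻ x, ‖iteratedFDeriv ℝ 1 (W t₀) x‖ₑ ^ 2 < ⊤) :
    ∃ c : EuclideanSpace ℝ (Fin 3), Tendsto (W t₀) (cocompact (EuclideanSpace ℝ (Fin 3))) (𝓝 c) := by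
  have hsm : ContDiffOn ℝ (⊤ : ℕ∞) (uncurry W) (Iio 0 ×ˢ univ) := hW.smooth
  have hcd : ContDiff ℝ 1 (W t₀) :=
    (hsm.comp_contDiff (contDiff_prodMk_right t₀) fun x => mk_mem_prod (mem_Iio.2 ht₀) (mem_univ x)).of_le
      (by exact_mod_cast le_top)
  obtain ⟨B, hB⟩ := knss_fderiv_bounded W hW hrep t₀ ht₀
  have hD : ∫⁻ x, ‖fderiv ℝ (W t₀) x‖ₑ ^ 2 < ⊤ := by
    have : ∀ x, ‖fderiv ℝ (W t₀) x‖ₑ = ‖iteratedFDeriv ℝ 1 (W t₀) x‖ₑ := by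
      intro x
      rw [← ofReal_norm, ← ofReal_norm, ← norm_iteratedFDeriv_fderiv, norm_iteratedFDeriv_zero]
    simp_rw [this]
    exact h1
  obtain ⟨c, -, hdec, -⟩ := ExtremiserLiouville.exists_farFieldLimit hcd (fun x => hW.norm_le_one t₀ ht₀ x) hB hD
  refine ⟨c, ?_⟩
  have := hdec.add_const c
  simpa using this

/-- **T2 · farField** (part (a) PROVED as `farFieldValue`; composed with the OPEN part (b) `stub_farFieldGradient : Sig.T2b`). -/
theorem farField : Sig.T2 := by
  intro W hW t₀ ht₀ h1
  obtain ⟨c, hc⟩ := farFieldValue W hW.1 hW.2 t₀ ht₀ h1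
  exact ⟨c, hc, stub_farFieldGradient W hW t₀ ht₀ h1⟩

end T2aProof

/-- **T3 · stub_bernoulliPressure** (L; known mechanism, the heavy stub — see `Sig.T3`). -/
theorem stub_bernoulliPressure : Sig.T3 := by
  sorry

section T4Proof
namespace T4Proof
open Literature.Analysis Literature.Analysis.FluidPDE Literature.Analysis.ODE TopologicalSpace

/-! ### Elementary helpers -/

theorem frobeniusNormSq_le_three_mul (L : (EuclideanSpace ℝ (Fin 3)) →L[ℝ] (EuclideanSpace ℝ (Fin 3))) : frobeniusNormSq L ≤ 3 * ‖L‖ ^ 2 := by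
  set b := stdOrthonormalBasis ℝ (EuclideanSpace ℝ (Fin 3))
  have h1 : ∀ i, ‖L (b i)‖ ^ 2 ≤ ‖L‖ ^ 2 := fun i => by
    have := L.le_opNorm (b i)
    rw [b.orthonormal.1 i, mul_one] at this
    exact pow_le_pow_left₀ (norm_nonneg _) this 2
  calc frobeniusNormSq L = ∑ i, ‖L (b i)‖ ^ 2 := rfl
    _ ≤ ∑ _i, ‖L‖ ^ 2 := Finset.sum_le_sum fun i _ => h1 i
    _ = 3 * ‖L‖ ^ 2 := by
      rw [Finset.sum_const, Finset.card_univ, nsmul_eq_mul]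
      simp [finrank_euclideanSpace]

theorem eq_zero_of_frobeniusNormSq_le_zero {L : (EuclideanSpace ℝ (Fin 3)) →L[ℝ] (EuclideanSpace ℝ (Fin 3))} (h : frobeniusNormSq L ≤ 0) : L = 0 := by
  have h1 : ‖L‖ ^ 2 ≤ 0 := (sq_opNorm_le_frobeniusNormSq L).trans h
  have h2 : ‖L‖ = 0 := by nlinarith [norm_nonneg L]
  exact norm_eq_zero.1 h2

theorem tendsto_cocompact_of_norm {ι : Type*} {f : ι → (EuclideanSpace ℝ (Fin 3))} {l : Filter ι}
    (h : Tendsto (fun s => ‖f s‖) l atTop) : Tendsto f l (cocompact (EuclideanSpace ℝ (Fin 3))) := by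
  rw [← Metric.cobounded_eq_cocompact]
  exact tendsto_norm_atTop_iff_cobounded.1 h

theorem tendsto_atTop_of_linear_lb {f : ℝ → ℝ} {τ R M : ℝ} (hM : 0 < M)
    (h : ∀ s, τ ≤ s → R + M / 2 * (s - τ) ≤ f s) : Tendsto f atTop atTop := by
  refine tendsto_atTop_atTop.2 fun b => ⟨max τ (τ + 2 * |b - R| / M), fun s hs => ?_⟩
  have hτs : τ ≤ s := le_trans (le_max_left _ _) hs
  have h2 : τ + 2 * |b - R| / M ≤ s := le_trans (le_max_right _ _) hs
  have h3 : |b - R| ≤ M / 2 * (s - τ) := by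
    have : 2 * |b - R| / M ≤ s - τ := by linarith
    have h4 : 2 * |b - R| ≤ (s - τ) * M := by rwa [div_le_iff₀ hM] at this
    nlinarith
  have := h s hτs
  linarith [le_abs_self (b - R)]

/-- A vector orthogonal to a given one, nonzero (dimension `3 ≥ 2`). -/
theorem exists_ne_zero_inner_eq_zero (e : (EuclideanSpace ℝ (Fin 3))) : ∃ v : (EuclideanSpace ℝ (Fin 3)), v ≠ 0 ∧ ⟪v, e⟫ = 0 := by
  by_cases h0 : e 0 = 0
  · refine ⟨EuclideanSpace.single 0 1, ?_, ?_⟩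
    · intro h
      have := congrArg (fun w : (EuclideanSpace ℝ (Fin 3)) => w 0) h
      simp at this
    · rw [EuclideanSpace.inner_single_left]; simp [h0]
  · refine ⟨e 1 • EuclideanSpace.single 0 1 - e 0 • EuclideanSpace.single 1 1, ?_, ?_⟩
    · intro h
      have := congrArg (fun w : (EuclideanSpace ℝ (Fin 3)) => w 1) h
      simp at this
      exact h0 this
    · rw [inner_sub_left, real_inner_smul_left, real_inner_smul_left, EuclideanSpace.inner_single_left,
        EuclideanSpace.inner_single_left]
      simp; ring

/-! ### The escape lemma for a single curve -/

/-- **Escape.** A curve of speed `≤ M` driven by a field whose component along the unit vector `e`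
is `≥ M/2` outside the ball `B_R`, started far from the origin with axial coordinate `≥ -A`, has
`‖γ s‖ ≥ R + (M/2)(s - τ)` for `s ≥ τ := (2(R+A)+2)/M`. -/
theorem escape {γ : ℝ → (EuclideanSpace ℝ (Fin 3))} {F : (EuclideanSpace ℝ (Fin 3)) → (EuclideanSpace ℝ (Fin 3))} {e : (EuclideanSpace ℝ (Fin 3))} {M R A : ℝ} (hM : 0 < M) (hR : 0 ≤ R) (hA : 0 ≤ A)
    (hγ : ∀ s, HasDerivAt γ (F (γ s)) s) (hFM : ∀ x, ‖F x‖ ≤ M) (he : ‖e‖ = 1)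
    (hfar : ∀ x, R ≤ ‖x‖ → M / 2 ≤ ⟪F x, e⟫)
    (h0a : -A ≤ ⟪γ 0, e⟫) (h0 : R + (2 * (R + A) + 2) ≤ ‖γ 0‖) :
    ∀ s, (2 * (R + A) + 2) / M ≤ s → R + M / 2 * (s - (2 * (R + A) + 2) / M) ≤ ‖γ s‖ := by
  set τ : ℝ := (2 * (R + A) + 2) / M with hτdef
  have hMτ : M * τ = 2 * (R + A) + 2 := by rw [hτdef]; field_simp
  have hτ0 : 0 < τ := by rw [hτdef]; positivity
  -- the axial coordinate
  set a : ℝ → ℝ := fun s => ⟪γ s, e⟫ with hadef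
  have ha : ∀ s, HasDerivAt a ⟪F (γ s), e⟫ s := fun s => by
    have := (hγ s).inner ℝ (hasDerivAt_const s e)
    simpa using this
  have hadiff : Differentiable ℝ a := fun s => (ha s).differentiableAt
  have hacont : Continuous a := hadiff.continuous
  have ha_le : ∀ s, a s ≤ ‖γ s‖ := fun s => by
    have := real_inner_le_norm (γ s) e
    rw [he, mul_one] at this
    exact this
  have hderiv : ∀ s, deriv a s = ⟪F (γ s), e⟫ := fun s => (ha s).deriv
  -- speed bound on `[0, τ]`
  have hspeed : ∀ s ∈ Icc (0 : ℝ) τ, ‖γ s - γ 0‖ ≤ M * (s - 0) :=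
    norm_image_sub_le_of_norm_deriv_le_segment' (f' := fun s => F (γ s))
      (fun s _ => (hγ s).hasDerivWithinAt) fun s _ => hFM _
  have hfar0 : ∀ s ∈ Icc (0 : ℝ) τ, R ≤ ‖γ s‖ := fun s hs => by
    have h1 := hspeed s hs
    have h2 : ‖γ 0‖ - ‖γ s - γ 0‖ ≤ ‖γ s‖ := by
      have := norm_sub_norm_le (γ 0) (γ s)
      rw [norm_sub_rev] at this
      linarith
    have h3 : M * s ≤ M * τ := mul_le_mul_of_nonneg_left hs.2 hM.le
    nlinarith [hs.1, hs.2]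
  -- `a τ ≥ R + 1`
  have haτ : R + 1 ≤ a τ := by
    have hmono := (convex_Icc (0 : ℝ) τ).mul_sub_le_image_sub_of_le_deriv hacont.continuousOn
      (hadiff.differentiableOn) (C := M / 2) (fun s hs => by
        rw [interior_Icc] at hs
        rw [hderiv]; exact hfar _ (hfar0 s ⟨hs.1.le, hs.2.le⟩))
      0 (left_mem_Icc.2 hτ0.le) τ (right_mem_Icc.2 hτ0.le) hτ0.le
    have : M / 2 * (τ - 0) = R + A + 1 := by nlinarith [hMτ]
    have h00 : a 0 = ⟪γ 0, e⟫ := rfl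
    linarith
  -- bootstrap: `a s > R` for all `s ≥ τ`
  have hboot : ∀ s, τ ≤ s → R < a s := by
    by_contra hcon
    push Not at hcon
    obtain ⟨s', hs'τ, hs'a⟩ := hcon
    set S : Set ℝ := Ici τ ∩ {s | a s ≤ R} with hSdef
    have hSc : IsClosed S := isClosed_Ici.inter (isClosed_le hacont continuous_const)
    have hSne : S.Nonempty := ⟨s', hs'τ, hs'a⟩
    have hSbdd : BddBelow S := ⟨τ, fun s hs => hs.1⟩
    set s₁ := sInf S with hs₁def
    have hs₁ : s₁ ∈ S := hSc.csInf_mem hSne hSbdd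
    have hτs₁ : τ < s₁ := by
      rcases eq_or_lt_of_le (mem_Ici.1 hs₁.1) with h | h
      · exfalso
        have h2 : a s₁ ≤ R := hs₁.2
        rw [← h] at h2
        linarith
      · exact h
    have hbefore : ∀ u ∈ Ico τ s₁, R < a u := fun u hu => by
      by_contra h
      push Not at h
      have := csInf_le hSbdd ⟨hu.1, h⟩
      exact absurd this (not_le.2 hu.2)
    have hmono := (convex_Icc τ s₁).mul_sub_le_image_sub_of_le_deriv hacont.continuousOn
      (hadiff.differentiableOn) (C := M / 2) (fun u hu => by
        rw [interior_Icc] at hu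
        rw [hderiv]
        exact hfar _ ((hbefore u ⟨hu.1.le, hu.2⟩).le.trans (ha_le u)))
      τ (left_mem_Icc.2 hτs₁.le) s₁ (right_mem_Icc.2 hτs₁.le) hτs₁.le
    have h2 : a s₁ ≤ R := hs₁.2
    nlinarith
  -- linear growth after `τ`
  intro s hs
  have hmono := (convex_Ici τ).mul_sub_le_image_sub_of_le_deriv hacont.continuousOn
    (hadiff.differentiableOn) (C := M / 2) (fun u hu => by
      rw [interior_Ici] at hu
      rw [hderiv]
      exact hfar _ ((hboot u (le_of_lt hu)).le.trans (ha_le u)))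
    τ (self_mem_Ici) s hs hs
  linarith [ha_le s]

/-! ### Escaping streamlines of a constant-speed field with a far-field value -/

/-- For a globally Lipschitz field of constant speed `M > 0` with far-field value `c`, there is an
open nonempty set of initial points whose (global) streamlines tend to infinity in both time
directions. -/
theorem exists_escaping_streamlines {V : (EuclideanSpace ℝ (Fin 3)) → (EuclideanSpace ℝ (Fin 3))} {K : ℝ≥0} {M : ℝ} {c : (EuclideanSpace ℝ (Fin 3))}
    (hLip : LipschitzWith K V) (hM : 0 < M) (hVM : ∀ x, ‖V x‖ = M)
    (hVc : Tendsto V (cocompact (EuclideanSpace ℝ (Fin 3))) (𝓝 c)) :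
    ∃ U : Set (EuclideanSpace ℝ (Fin 3)), IsOpen U ∧ U.Nonempty ∧ ∀ x₀ ∈ U,
      Tendsto (lipschitzFlow hLip x₀) atTop (cocompact (EuclideanSpace ℝ (Fin 3))) ∧
      Tendsto (lipschitzFlow hLip x₀) atBot (cocompact (EuclideanSpace ℝ (Fin 3))) := by
  -- `‖c‖ = M`
  have hcM : ‖c‖ = M := by
    set v : (EuclideanSpace ℝ (Fin 3)) := EuclideanSpace.single 0 (1 : ℝ) with hv
    have hv1 : ‖v‖ = 1 := by rw [hv, PiLp.norm_single]; simp
    have hseq : Tendsto (fun n : ℕ => (n : ℝ) • v) atTop (cocompact (EuclideanSpace ℝ (Fin 3))) := by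
      apply tendsto_cocompact_of_norm
      have : (fun n : ℕ => ‖(n : ℝ) • v‖) = fun n : ℕ => (n : ℝ) := by
        funext n; rw [norm_smul, hv1, mul_one, Real.norm_eq_abs, abs_of_nonneg (Nat.cast_nonneg n)]
      rw [this]; exact tendsto_natCast_atTop_atTop
    have h := (hVc.comp hseq).norm
    have hconst : (fun n : ℕ => ‖(V ∘ fun n : ℕ => (n : ℝ) • v) n‖) = fun _ => M := funext fun n => hVM _
    rw [hconst] at h
    exact (tendsto_nhds_unique tendsto_const_nhds h).symm
  have hc0 : 0 < ‖c‖ := by rw [hcM]; exact hM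
  set e : (EuclideanSpace ℝ (Fin 3)) := M⁻¹ • c with hedef
  have he : ‖e‖ = 1 := by
    rw [hedef, norm_smul, hcM, Real.norm_eq_abs, abs_of_pos (inv_pos.2 hM), inv_mul_cancel₀ hM.ne']
  -- far-field threshold `R`
  have hev : ∀ᶠ x in cocompact (EuclideanSpace ℝ (Fin 3)), dist (V x) c < M / 2 := Metric.tendsto_nhds.1 hVc _ (by positivity)
  rw [← Metric.cobounded_eq_cocompact] at hev
  obtain ⟨r, -, hr⟩ := (Metric.hasBasis_cobounded_compl_closedBall (0 : (EuclideanSpace ℝ (Fin 3)))).eventually_iff.1 hev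
  set R : ℝ := max r 0 + 1 with hRdef
  have hR0 : 0 ≤ R := by rw [hRdef]; positivity
  have hRfar : ∀ x : (EuclideanSpace ℝ (Fin 3)), R ≤ ‖x‖ → ‖V x - c‖ ≤ M / 2 := fun x hx => by
    have hx' : x ∈ (closedBall (0 : (EuclideanSpace ℝ (Fin 3))) r)ᶜ := by
      rw [mem_compl_iff, mem_closedBall, dist_zero_right]
      intro h
      have : r < R := by rw [hRdef]; linarith [le_max_left r 0]
      linarith
    have := hr hx'
    rw [dist_eq_norm] at this
    exact this.le
  have hfar : ∀ x : (EuclideanSpace ℝ (Fin 3)), R ≤ ‖x‖ → M / 2 ≤ ⟪V x, e⟫ := fun x hx => by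
    have h1 : ⟪V x, e⟫ = M⁻¹ * ⟪V x, c⟫ := by rw [hedef, real_inner_smul_right]
    have h2 : ⟪V x, c⟫ = ⟪V x - c, c⟫ + ‖c‖ ^ 2 := by
      rw [inner_sub_left, real_inner_self_eq_norm_sq]; ring
    have h3 : -(M / 2 * M) ≤ ⟪V x - c, c⟫ := by
      have h4 := abs_real_inner_le_norm (V x - c) c
      have h5 : ‖V x - c‖ * ‖c‖ ≤ M / 2 * M := by
        rw [hcM]; exact mul_le_mul_of_nonneg_right (hRfar x hx) hM.le
      linarith [neg_abs_le ⟪V x - c, c⟫]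
    rw [h1, h2, hcM]
    rw [← sub_nonneg]
    have : M⁻¹ * (⟪V x - c, c⟫ + M ^ 2) - M / 2 = M⁻¹ * (⟪V x - c, c⟫ + M / 2 * M) := by
      field_simp; ring
    rw [this]
    exact mul_nonneg (inv_pos.2 hM).le (by linarith)
  -- the set `U`
  set L : ℝ := R + (2 * (R + 1) + 2) with hLdef
  refine ⟨{x | |⟪x, e⟫| < 1 ∧ L < ‖x‖}, ?_, ?_, ?_⟩
  · have h1 : Continuous fun x : (EuclideanSpace ℝ (Fin 3)) => |⟪x, e⟫| := (continuous_id.inner continuous_const).abs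
    have h2 : Continuous fun x : (EuclideanSpace ℝ (Fin 3)) => ‖x‖ := continuous_norm
    exact (isOpen_lt h1 continuous_const).and (isOpen_lt continuous_const h2)
  · obtain ⟨v, hv0, hve⟩ := exists_ne_zero_inner_eq_zero e
    have hvn : 0 < ‖v‖ := norm_pos_iff.2 hv0
    refine ⟨((L + 1) / ‖v‖) • v, ?_, ?_⟩
    · show |⟪((L + 1) / ‖v‖) • v, e⟫| < 1
      rw [real_inner_smul_left, hve, mul_zero, abs_zero]; exact one_pos
    · show L < ‖((L + 1) / ‖v‖) • v‖
      have hL0 : 0 < L + 1 := by rw [hLdef]; positivity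
      rw [norm_smul, Real.norm_eq_abs, abs_of_pos (div_pos hL0 hvn), div_mul_cancel₀ _ hvn.ne']
      linarith
  · rintro x₀ ⟨hx₀a, hx₀n⟩
    set γ := lipschitzFlow hLip x₀ with hγdef
    have hγ : ∀ s, HasDerivAt γ (V (γ s)) s := hasDerivAt_lipschitzFlow hLip x₀
    have hγ0 : γ 0 = x₀ := lipschitzFlow_zero hLip x₀
    have hVle : ∀ x, ‖V x‖ ≤ M := fun x => (hVM x).le
    constructor
    · -- forward escape
      have hesc := escape (γ := γ) (F := V) (e := e) (A := 1) hM hR0 zero_le_one hγ hVle he hfar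
        (by rw [hγ0]; linarith [(abs_lt.1 hx₀a).1]) (by rw [hγ0]; exact hx₀n.le)
      exact tendsto_cocompact_of_norm (tendsto_atTop_of_linear_lb hM hesc)
    · -- backward escape: reverse time, field `-V`, direction `-e`
      set γb : ℝ → (EuclideanSpace ℝ (Fin 3)) := fun s => γ (-s) with hγbdef
      have hγb : ∀ s, HasDerivAt γb ((fun x => -V x) (γb s)) s := fun s => by
        have h1 := (hγ (-s)).scomp s ((hasDerivAt_id s).neg)
        have h2 : HasDerivAt (γ ∘ fun x => -id x) ((-1 : ℝ) • V (γ (-s))) s := by simpa using h1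
        simpa [hγbdef, Function.comp_def] using h2
      have hfar' : ∀ x : (EuclideanSpace ℝ (Fin 3)), R ≤ ‖x‖ → M / 2 ≤ ⟪(fun x => -V x) x, -e⟫ := fun x hx => by
        simp only [inner_neg_neg]; exact hfar x hx
      have he' : ‖-e‖ = 1 := by rw [norm_neg, he]
      have hesc := escape (γ := γb) (F := fun x => -V x) (e := -e) (A := 1) hM hR0 zero_le_one hγb
        (fun x => by rw [norm_neg]; exact hVle x) he' hfar'
        (by simp only [hγbdef, neg_zero, hγ0, inner_neg_right]; linarith [(abs_lt.1 hx₀a).2])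
        (by simp only [hγbdef, neg_zero, hγ0]; exact hx₀n.le)
      have h1 : Tendsto γb atTop (cocompact (EuclideanSpace ℝ (Fin 3))) := tendsto_cocompact_of_norm (tendsto_atTop_of_linear_lb hM hesc)
      have h2 := h1.comp tendsto_neg_atBot_atTop
      have h3 : (γb ∘ Neg.neg) = γ := by funext s; simp [hγbdef]
      rwa [h3] at h2

/-! ### The signed Bernoulli–Liouville lemma (T4ʳ) and the `m`-version (T4) -/

/-- **T4ʳ (signed form).** -/
theorem bernoulliLiouvilleSign (V : (EuclideanSpace ℝ (Fin 3)) → (EuclideanSpace ℝ (Fin 3))) (q : (EuclideanSpace ℝ (Fin 3)) → ℝ) (c : (EuclideanSpace ℝ (Fin 3))) (M B : ℝ)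
    (hV : ContDiff ℝ 2 V) (hq : ContDiff ℝ 1 q) (hM : 0 < M) (hVM : ∀ x, ‖V x‖ = M)
    (hB : ∀ x, ‖fderiv ℝ V x‖ ≤ B)
    (hDq : ∀ x, fderiv ℝ q x (V x) ≤ -(frobeniusNormSq (fderiv ℝ V x)))
    (hq0 : Tendsto q (cocompact (EuclideanSpace ℝ (Fin 3))) (𝓝 0)) (hVc : Tendsto V (cocompact (EuclideanSpace ℝ (Fin 3))) (𝓝 c))
    (hDV0 : Tendsto (fun x => fderiv ℝ V x) (cocompact (EuclideanSpace ℝ (Fin 3))) (𝓝 0)) :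
    ∃ U : Set (EuclideanSpace ℝ (Fin 3)), IsOpen U ∧ U.Nonempty ∧ ∀ x ∈ U, fderiv ℝ V x = 0 := by
  have hV1 : Differentiable ℝ V := hV.differentiable (by norm_num)
  have hq1 : Differentiable ℝ q := hq.differentiable one_ne_zero
  have hB0 : 0 ≤ B := (norm_nonneg _).trans (hB 0)
  have hLip : LipschitzWith (Real.toNNReal B) V :=
    lipschitzWith_of_nnnorm_fderiv_le hV1 fun x => by
      rw [← NNReal.coe_le_coe, coe_nnnorm, Real.coe_toNNReal B hB0]; exact hB x
  obtain ⟨U, hUo, hUne, hU⟩ := exists_escaping_streamlines hLip hM hVM hVc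
  refine ⟨U, hUo, hUne, fun x₀ hx₀ => ?_⟩
  obtain ⟨htop, hbot⟩ := hU x₀ hx₀
  set γ := lipschitzFlow hLip x₀ with hγdef
  have hγ : ∀ s, HasDerivAt γ (V (γ s)) s := hasDerivAt_lipschitzFlow hLip x₀
  have hγ0 : γ 0 = x₀ := lipschitzFlow_zero hLip x₀
  set g : ℝ → ℝ := q ∘ γ with hgdef
  have hg : ∀ s, HasDerivAt g (fderiv ℝ q (γ s) (V (γ s))) s := fun s =>
    (hq1 (γ s)).hasFDerivAt.comp_hasDerivAt s (hγ s)
  have hgdiff : Differentiable ℝ g := fun s => (hg s).differentiableAt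
  have hganti : Antitone g := antitone_of_deriv_nonpos hgdiff fun s => by
    rw [(hg s).deriv]
    linarith [hDq (γ s), frobeniusNormSq_nonneg (fderiv ℝ V (γ s))]
  have hgtop : Tendsto g atTop (𝓝 0) := hq0.comp htop
  have hgbot : Tendsto g atBot (𝓝 0) := hq0.comp hbot
  have hgzero : ∀ s, g s = 0 := fun s => by
    refine le_antisymm ?_ ?_
    · exact ge_of_tendsto hgbot (Filter.eventually_atBot.2 ⟨s, fun u hu => hganti hu⟩)
    · exact le_of_tendsto hgtop (Filter.eventually_atTop.2 ⟨s, fun u hu => hganti hu⟩)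
  have hg0' : HasDerivAt g 0 0 := by
    have : g = fun _ => (0 : ℝ) := funext hgzero
    rw [this]; exact hasDerivAt_const 0 0
  have hder0 : fderiv ℝ q x₀ (V x₀) = 0 := by
    have := (hg 0).unique hg0'
    rwa [hγ0] at this
  have hfr : frobeniusNormSq (fderiv ℝ V x₀) ≤ 0 := by linarith [hDq x₀]
  exact eq_zero_of_frobeniusNormSq_le_zero hfr

/-- **T4 (`m`-version).** -/
theorem bernoulliLiouville (V : (EuclideanSpace ℝ (Fin 3)) → (EuclideanSpace ℝ (Fin 3))) (q : (EuclideanSpace ℝ (Fin 3)) → ℝ) (c : (EuclideanSpace ℝ (Fin 3))) (M m B : ℝ)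
    (hV : ContDiff ℝ 2 V) (hq : ContDiff ℝ 1 q) (hM : 0 < M) (hVM : ∀ x, ‖V x‖ = M)
    (hB : ∀ x, ‖fderiv ℝ V x‖ ≤ B)
    (hDq : ∀ x, fderiv ℝ q x (V x) = -(frobeniusNormSq (fderiv ℝ V x)) - m)
    (hq0 : Tendsto q (cocompact (EuclideanSpace ℝ (Fin 3))) (𝓝 0)) (hVc : Tendsto V (cocompact (EuclideanSpace ℝ (Fin 3))) (𝓝 c))
    (hDV0 : Tendsto (fun x => fderiv ℝ V x) (cocompact (EuclideanSpace ℝ (Fin 3))) (𝓝 0)) :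
    ∃ U : Set (EuclideanSpace ℝ (Fin 3)), IsOpen U ∧ U.Nonempty ∧ ∀ x ∈ U, fderiv ℝ V x = 0 := by
  rcases le_or_gt 0 m with hm | hm
  · exact bernoulliLiouvilleSign V q c M B hV hq hM hVM hB (fun x => by rw [hDq x]; linarith) hq0 hVc hDV0
  · -- `m < 0` is impossible: along an escaping streamline `g' = -|DV|² - m ≥ -m/2 > 0` eventually,
    -- so `g → +∞`, contradicting `q → 0`.
    exfalso
    have hV1 : Differentiable ℝ V := hV.differentiable (by norm_num)
    have hq1 : Differentiable ℝ q := hq.differentiable one_ne_zero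
    have hB0 : 0 ≤ B := (norm_nonneg _).trans (hB 0)
    have hLip : LipschitzWith (Real.toNNReal B) V :=
      lipschitzWith_of_nnnorm_fderiv_le hV1 fun x => by
        rw [← NNReal.coe_le_coe, coe_nnnorm, Real.coe_toNNReal B hB0]; exact hB x
    obtain ⟨U, hUo, ⟨x₀, hx₀⟩, hU⟩ := exists_escaping_streamlines hLip hM hVM hVc
    obtain ⟨htop, -⟩ := hU x₀ hx₀
    set γ := lipschitzFlow hLip x₀ with hγdef
    have hγ : ∀ s, HasDerivAt γ (V (γ s)) s := hasDerivAt_lipschitzFlow hLip x₀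
    set g : ℝ → ℝ := q ∘ γ with hgdef
    have hg : ∀ s, HasDerivAt g (-(frobeniusNormSq (fderiv ℝ V (γ s))) - m) s := fun s => by
      have := (hq1 (γ s)).hasFDerivAt.comp_hasDerivAt s (hγ s)
      rwa [hDq (γ s)] at this
    have hgdiff : Differentiable ℝ g := fun s => (hg s).differentiableAt
    have hgcont : Continuous g := hgdiff.continuous
    have hgtop : Tendsto g atTop (𝓝 0) := hq0.comp htop
    -- `|DV(γ s)|²_F → 0`
    have hDVγ : Tendsto (fun s => fderiv ℝ V (γ s)) atTop (𝓝 0) := hDV0.comp htop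
    have hnorm : Tendsto (fun s => ‖fderiv ℝ V (γ s)‖) atTop (𝓝 0) := by
      have := hDVγ.norm; simpa using this
    have hfrob : Tendsto (fun s => frobeniusNormSq (fderiv ℝ V (γ s))) atTop (𝓝 0) := by
      refine squeeze_zero (fun s => frobeniusNormSq_nonneg _) (fun s => frobeniusNormSq_le_three_mul _) ?_
      have := (hnorm.pow 2).const_mul 3
      simpa using this
    -- eventually `g' ≥ -m/2`
    have hev : ∀ᶠ s in atTop, frobeniusNormSq (fderiv ℝ V (γ s)) < -m / 2 :=
      hfrob.eventually (gt_mem_nhds (by linarith))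
    obtain ⟨s₀, hs₀⟩ := Filter.eventually_atTop.1 hev
    have hev1 : ∀ᶠ s in atTop, g s < 1 := hgtop.eventually (gt_mem_nhds one_pos)
    obtain ⟨s₁, hs₁⟩ := Filter.eventually_atTop.1 hev1
    have hmono := (convex_Ici s₀).mul_sub_le_image_sub_of_le_deriv hgcont.continuousOn
      (hgdiff.differentiableOn) (C := -m / 2) (fun u hu => by
        rw [interior_Ici] at hu
        rw [(hg u).deriv]
        linarith [hs₀ u (le_of_lt hu)])
    set s : ℝ := max (max s₀ s₁) (s₀ + (2 * |1 - g s₀| + 2) / (-m)) with hsdef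
    have hs0 : s₀ ≤ s := le_trans (le_max_left _ _) (le_max_left _ _)
    have hs1 : s₁ ≤ s := le_trans (le_max_right _ _) (le_max_left _ _)
    have hs2 : s₀ + (2 * |1 - g s₀| + 2) / (-m) ≤ s := le_max_right _ _
    have h1 := hmono s₀ self_mem_Ici s hs0 hs0
    have h2 := hs₁ s hs1
    have hm' : 0 < -m := by linarith
    have h3 : (2 * |1 - g s₀| + 2) / (-m) ≤ s - s₀ := by linarith
    have h4 : 2 * |1 - g s₀| + 2 ≤ (s - s₀) * (-m) := by rwa [div_le_iff₀ hm'] at h3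
    have h5 : -m / 2 * (s - s₀) ≥ |1 - g s₀| + 1 := by nlinarith
    linarith [le_abs_self (1 - g s₀)]

end T4Proof
end T4Proof

/-- **T4 · bernoulliLiouville — PROVED (REV 1.5).**  THE LEVER: global streamlines (`Literature.Analysis.ODE.lipschitzFlow`), the
escape lemma `T4Proof.escape` (bounded crossing time + bootstrap, no decay rate), `q ∘ γ` antitone with equal limits `0`; the
`m < 0` branch dies because `(q ∘ γ)′ → −m > 0` along an escaping streamline.  Std axioms. -/
theorem bernoulliLiouville : Sig.T4 := by
  intro V q c M m B hV hq hM hVM hB hDq hq0 hVc hDV0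
  exact T4Proof.bernoulliLiouville V q c M m B hV hq hM hVM hB hDq hq0 hVc hDV0

/-! ## Rigidity, dynamic form — PROVED from K1a and T1–T4 (this replaces line B's use of K1b) -/

/-- **K1 from K1a + T1 + T2 + T3 + T4 (kernel-checked).**  Take the constant-speed window (T1) around an extremal time `t₀`, the far-field
package of the slice `W t₀` (T2), the Bernoulli potential `q` (T3); the Bernoulli–Liouville lemma (T4) makes `DW(t₀,·)` vanish on a nonempty
open set, hence everywhere by analyticity (K1a, identity theorem for `fderiv ℝ (W t₀)`), contradicting `∃ x, DW(t₀,x) ≠ 0`. -/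
theorem extremalAncient_false_of_bernoulli (h1a : Sig.K1A) (hT1 : Sig.T1) (hT2 : Sig.T2) (hT3 : Sig.T3) (hT4 : Sig.T4) : Sig.K1 := by
  rintro ⟨W, a, b, hW, hab, hb0, hae⟩
  obtain ⟨t₀, M, s, hat, htb, hs, hlim, hMeq, hM0, hcd, ⟨B, hB⟩, hD1, ⟨x₁, hx₁⟩⟩ := hT1 W a b hW hab hb0 hae (h1a W hW)
  have ht₀ : t₀ < 0 := lt_of_lt_of_le htb hb0
  obtain ⟨c, hc, hgrad⟩ := hT2 W hW t₀ ht₀ hD1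
  obtain ⟨q, m, hq, hid, hq0⟩ := hT3 W hW t₀ M s ht₀ hs hlim hMeq hD1
  obtain ⟨U, hUo, ⟨z₀, hz₀⟩, hU⟩ := hT4 (W t₀) q c (M t₀) m B hcd hq hM0 hMeq hB hid hq0 hc hgrad
  have han : AnalyticOnNhd ℝ (W t₀) Set.univ := h1a W hW t₀ ht₀
  have hfan : AnalyticOnNhd ℝ (fderiv ℝ (W t₀)) Set.univ := han.fderiv
  have hev : fderiv ℝ (W t₀) =ᶠ[𝓝 z₀] 0 := by
    filter_upwards [hUo.mem_nhds hz₀] with x hx using hU x hx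
  have hzero := hfan.eqOn_zero_of_preconnected_of_eventuallyEq_zero isPreconnected_univ (Set.mem_univ z₀) hev
  exact hx₁ (hzero (Set.mem_univ x₁))

/-- **Composition (kernel-checked).**  K2 and K1 give ¬P; the rest is the block-to-log bookkeeping described in the module
docstring (`blocksToLog_general`, `intervalIntegrable_coeff_sq_div`, `sharpDepletion_gt`, `sharpDepletion_le`), with
θ := √(max β 0)/κ⋆ and B := max β 0 · L. -/
theorem NearExtremalTransience_of :
    Summit.NavierStokesRegularity.NavierStokesRegularity.Theses.ExtremiserTransience.NearExtremalTransience := by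
  -- COMPACTNESS (stub K2) and RIGIDITY (proved above from the stubs K1a, K1b): the registered stubs enter BY NAME.
  have hK2 : (∀ β : ℝ, β < (sInf {κ : ℝ | (∀ (v : EuclideanSpace ℝ (Fin 3) → EuclideanSpace ℝ (Fin 3)) (M B : ℝ), ContDiff ℝ (⊤ : ℕ∞) v → Literature.Analysis.FluidPDE.VectorCalculus.IsDivFree v → (∀ x, ‖v x‖ ≤ M) → (∀ x, ‖fderiv ℝ v x‖ ≤ B) → (∫⁻ x, ‖iteratedFDeriv ℝ 0 v x‖ₑ ^ 2 < ⊤) → (∫⁻ x, ‖iteratedFDeriv ℝ 1 v x‖ₑ ^ 2 < ⊤) → (∫⁻ x, ‖iteratedFDeriv ℝ 2 v x‖ₑ ^ 2 < ⊤) → |∫ x, ⟪Literature.Analysis.FluidPDE.curl v x, fderiv ℝ v x (Literature.Analysis.FluidPDE.curl v x)⟫_ℝ| ≤ κ * M * Real.sqrt (∫ x, ‖Literature.Analysis.FluidPDE.curl v x‖ ^ 2) * Real.sqrt (∫ x, Literature.Analysis.FluidPDE.frobeniusNormSq (fderiv ℝ (Literature.Analysis.FluidPDE.curl v) x)))}) ^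 2 → ∀ L : ℝ, 0 < L → ∃ (C ν T : ℝ) (u : ℝ → EuclideanSpace ℝ (Fin 3) → EuclideanSpace ℝ (Fin 3)) (p : ℝ → EuclideanSpace ℝ (Fin 3) → ℝ), 0 < C ∧ 0 < ν ∧ 0 < T ∧ Literature.Analysis.FluidPDE.IsClassicalNSSolutionOn (Set.Ico 0 T) ν 0 u p ∧ Literature.Analysis.FluidPDE.IsLerayHopfOn T ν 0 (u 0) u ∧ Literature.Analysis.FluidPDE.HasRapidSpatialDecay (u 0) ∧ (∀ᶠ t in 𝓝[<] T, ∀ x, Real.sqrt (T - t) * ‖u t x‖ ≤ C * Real.sqrt ν) ∧ ¬ Literature.Analysis.FluidPDE.HasSmoothExtensionPast ν 0 u T ∧ ∀ (k : ℝ → ℝ), Measurable k → (∀ τ, 0 ≤ k τ ∧ k τ ≤ 1) → (∀ t ∈ Set.Ico 0 T, ∀ M : ℝ, (∀ x, ‖u t x‖ ≤ M) → |∫ x, ⟪Literature.Analysis.FluidPDE.curl (u t) x, fderiv ℝ (u t) x (Literature.Analysis.FluidPDE.curl (u t) x)⟫_ℝ| ≤ k t * M * Real.sqrt (∫ x, ‖Literature.Analysis.FluidPDE.curl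 (u t) x‖ ^ 2) * Real.sqrt (∫ x, Literature.Analysis.FluidPDE.frobeniusNormSq (fderiv ℝ (Literature.Analysis.FluidPDE.curl (u t)) x))) → ∀ t₁ ∈ Set.Ico 0 T, ∃ s₁ s₂ : ℝ, t₁ ≤ s₁ ∧ s₁ < s₂ ∧ s₂ < T ∧ L ≤ Real.log ((T - s₁) / (T - s₂)) ∧ β * Real.log ((T - s₁) / (T - s₂)) < ∫ τ in s₁..s₂, k τ ^ 2 / (T - τ)) → ∃ (W : ℝ → EuclideanSpace ℝ (Fin 3) → EuclideanSpace ℝ (Fin 3)) (a b : ℝ), (Literature.Analysis.FluidPDE.IsKNSSBlowupLimit W ∧ (∀ s t : ℝ, s < t → t < 0 → ∀ x, W t x = Literature.Analysis.FluidPDE.heatFlow (W s) (t - s) x - Literature.Analysis.FluidPDE.oseenDuhamel 1 s W W t x)) ∧ a < b ∧ b ≤ 0 ∧ ∀ᵐ t : ℝ, t ∈ Set.Ioo a b → (ContDiff ℝ (⊤ : ℕ∞) (W t) ∧ Literature.Analysis.FluidPDE.VectorCalculus.IsDivFree (W t) ∧ (∃ B : ℝ, ∀ x, ‖fderiv ℝ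 (W t) x‖ ≤ B) ∧ (∫⁻ x, ‖iteratedFDeriv ℝ 1 (W t) x‖ₑ ^ 2 < ⊤) ∧ (∫⁻ x, ‖iteratedFDeriv ℝ 2 (W t) x‖ₑ ^ 2 < ⊤) ∧ ∃ M : ℝ, (∀ x, ‖(W t) x‖ ≤ M) ∧ 0 < M * Real.sqrt (∫ x, ‖Literature.Analysis.FluidPDE.curl (W t) x‖ ^ 2) * Real.sqrt (∫ x, Literature.Analysis.FluidPDE.frobeniusNormSq (fderiv ℝ (Literature.Analysis.FluidPDE.curl (W t)) x)) ∧ (sInf {κ : ℝ | (∀ (v : EuclideanSpace ℝ (Fin 3) → EuclideanSpace ℝ (Fin 3)) (M B : ℝ), ContDiff ℝ (⊤ : ℕ∞) v → Literature.Analysis.FluidPDE.VectorCalculus.IsDivFree v → (∀ x, ‖v x‖ ≤ M) → (∀ x, ‖fderiv ℝ v x‖ ≤ B) → (∫⁻ x, ‖iteratedFDeriv ℝ 0 v x‖ₑ ^ 2 < ⊤) → (∫⁻ x, ‖iteratedFDeriv ℝ 1 v x‖ₑ ^ 2 < ⊤) → (∫⁻ x, ‖iteratedFDeriv ℝ 2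 v x‖ₑ ^ 2 < ⊤) → |∫ x, ⟪Literature.Analysis.FluidPDE.curl v x, fderiv ℝ v x (Literature.Analysis.FluidPDE.curl v x)⟫_ℝ| ≤ κ * M * Real.sqrt (∫ x, ‖Literature.Analysis.FluidPDE.curl v x‖ ^ 2) * Real.sqrt (∫ x, Literature.Analysis.FluidPDE.frobeniusNormSq (fderiv ℝ (Literature.Analysis.FluidPDE.curl v) x)))}) * M * Real.sqrt (∫ x, ‖Literature.Analysis.FluidPDE.curl (W t) x‖ ^ 2) * Real.sqrt (∫ x, Literature.Analysis.FluidPDE.frobeniusNormSq (fderiv ℝ (Literature.Analysis.FluidPDE.curl (W t)) x)) ≤ |∫ x, ⟪Literature.Analysis.FluidPDE.curl (W t) x, fderiv ℝ (W t) x (Literature.Analysis.FluidPDE.curl (W t) x)⟫_ℝ|) := stub_extremalPersistenceCompactness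
  have hK1 : ¬ (∃ (W : ℝ → EuclideanSpace ℝ (Fin 3) → EuclideanSpace ℝ (Fin 3)) (a b : ℝ), (Literature.Analysis.FluidPDE.IsKNSSBlowupLimit W ∧ (∀ s t : ℝ, s < t → t < 0 → ∀ x, W t x = Literature.Analysis.FluidPDE.heatFlow (W s) (t - s) x - Literature.Analysis.FluidPDE.oseenDuhamel 1 s W W t x)) ∧ a < b ∧ b ≤ 0 ∧ ∀ᵐ t : ℝ, t ∈ Set.Ioo a b → (ContDiff ℝ (⊤ : ℕ∞) (W t) ∧ Literature.Analysis.FluidPDE.VectorCalculus.IsDivFree (W t) ∧ (∃ B : ℝ, ∀ x, ‖fderiv ℝ (W t) x‖ ≤ B) ∧ (∫⁻ x, ‖iteratedFDeriv ℝ 1 (W t) x‖ₑ ^ 2 < ⊤) ∧ (∫⁻ x, ‖iteratedFDeriv ℝ 2 (W t) x‖ₑ ^ 2 < ⊤) ∧ ∃ M : ℝ, (∀ x, ‖(W t) x‖ ≤ M) ∧ 0 < M * Real.sqrt (∫ x, ‖Literature.Analysis.FluidPDE.curl (W t) x‖ ^ 2) * Real.sqrt (∫ x, Literature.Analysis.FluidPDE.frobeniusNormSq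 (fderiv ℝ (Literature.Analysis.FluidPDE.curl (W t)) x)) ∧ (sInf {κ : ℝ | (∀ (v : EuclideanSpace ℝ (Fin 3) → EuclideanSpace ℝ (Fin 3)) (M B : ℝ), ContDiff ℝ (⊤ : ℕ∞) v → Literature.Analysis.FluidPDE.VectorCalculus.IsDivFree v → (∀ x, ‖v x‖ ≤ M) → (∀ x, ‖fderiv ℝ v x‖ ≤ B) → (∫⁻ x, ‖iteratedFDeriv ℝ 0 v x‖ₑ ^ 2 < ⊤) → (∫⁻ x, ‖iteratedFDeriv ℝ 1 v x‖ₑ ^ 2 < ⊤) → (∫⁻ x, ‖iteratedFDeriv ℝ 2 v x‖ₑ ^ 2 < ⊤) → |∫ x, ⟪Literature.Analysis.FluidPDE.curl v x, fderiv ℝ v x (Literature.Analysis.FluidPDE.curl v x)⟫_ℝ| ≤ κ * M * Real.sqrt (∫ x, ‖Literature.Analysis.FluidPDE.curl v x‖ ^ 2) * Real.sqrt (∫ x, Literature.Analysis.FluidPDE.frobeniusNormSq (fderiv ℝ (Literature.Analysis.FluidPDE.curl v) x)))}) * M * Real.sqrt (∫ x, ‖Literature.Analysis.FluidPDE.curl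 (W t) x‖ ^ 2) * Real.sqrt (∫ x, Literature.Analysis.FluidPDE.frobeniusNormSq (fderiv ℝ (Literature.Analysis.FluidPDE.curl (W t)) x)) ≤ |∫ x, ⟪Literature.Analysis.FluidPDE.curl (W t) x, fderiv ℝ (W t) x (Literature.Analysis.FluidPDE.curl (W t) x)⟫_ℝ|)) := extremalAncient_false_of_bernoulli analyticSlices constSpeedAccumulation farField stub_bernoulliPressure bernoulliLiouville
  have hnotP : ¬ (∀ β : ℝ, β < (sInf {κ : ℝ | (∀ (v : EuclideanSpace ℝ (Fin 3) → EuclideanSpace ℝ (Fin 3)) (M B : ℝ), ContDiff ℝ (⊤ : ℕ∞) v → Literature.Analysis.FluidPDE.VectorCalculus.IsDivFree v → (∀ x, ‖v x‖ ≤ M) → (∀ x, ‖fderiv ℝ v x‖ ≤ B) → (∫⁻ x, ‖iteratedFDeriv ℝ 0 v x‖ₑ ^ 2 < ⊤) → (∫⁻ x, ‖iteratedFDeriv ℝ 1 v x‖ₑ ^ 2 < ⊤) → (∫⁻ x, ‖iteratedFDeriv ℝ 2 v x‖ₑ ^ 2 < ⊤) → |∫ x, ⟪Literature.Analysis.FluidPDE.curl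 v x, fderiv ℝ v x (Literature.Analysis.FluidPDE.curl v x)⟫_ℝ| ≤ κ * M * Real.sqrt (∫ x, ‖Literature.Analysis.FluidPDE.curl v x‖ ^ 2) * Real.sqrt (∫ x, Literature.Analysis.FluidPDE.frobeniusNormSq (fderiv ℝ (Literature.Analysis.FluidPDE.curl v) x)))}) ^ 2 → ∀ L : ℝ, 0 < L → ∃ (C ν T : ℝ) (u : ℝ → EuclideanSpace ℝ (Fin 3) → EuclideanSpace ℝ (Fin 3)) (p : ℝ → EuclideanSpace ℝ (Fin 3) → ℝ), 0 < C ∧ 0 < ν ∧ 0 < T ∧ Literature.Analysis.FluidPDE.IsClassicalNSSolutionOn (Set.Ico 0 T) ν 0 u p ∧ Literature.Analysis.FluidPDE.IsLerayHopfOn T ν 0 (u 0) u ∧ Literature.Analysis.FluidPDE.HasRapidSpatialDecay (u 0) ∧ (∀ᶠ t in 𝓝[<] T, ∀ x, Real.sqrt (T - t) * ‖u t x‖ ≤ C * Real.sqrt ν) ∧ ¬ Literature.Analysis.FluidPDE.HasSmoothExtensionPast ν 0 u T ∧ ∀ (k : ℝ → ℝ), Measurable k → (∀ τ, 0 ≤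 k τ ∧ k τ ≤ 1) → (∀ t ∈ Set.Ico 0 T, ∀ M : ℝ, (∀ x, ‖u t x‖ ≤ M) → |∫ x, ⟪Literature.Analysis.FluidPDE.curl (u t) x, fderiv ℝ (u t) x (Literature.Analysis.FluidPDE.curl (u t) x)⟫_ℝ| ≤ k t * M * Real.sqrt (∫ x, ‖Literature.Analysis.FluidPDE.curl (u t) x‖ ^ 2) * Real.sqrt (∫ x, Literature.Analysis.FluidPDE.frobeniusNormSq (fderiv ℝ (Literature.Analysis.FluidPDE.curl (u t)) x))) → ∀ t₁ ∈ Set.Ico 0 T, ∃ s₁ s₂ : ℝ, t₁ ≤ s₁ ∧ s₁ < s₂ ∧ s₂ < T ∧ L ≤ Real.log ((T - s₁) / (T - s₂)) ∧ β * Real.log ((T - s₁) / (T - s₂)) < ∫ τ in s₁..s₂, k τ ^ 2 / (T - τ)) := fun hP => hK1 (hK2 hP)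
  -- Step 1: the uniform level β < κ⋆² and log-length L > 0.
  obtain ⟨β, hβ⟩ := not_forall.mp hnotP
  obtain ⟨hβlt, hβ2⟩ := Classical.not_imp.mp hβ
  obtain ⟨L, hL⟩ := not_forall.mp hβ2
  obtain ⟨hLpos, hrest⟩ := Classical.not_imp.mp hL
  -- constants of the sharp-constant API
  have hκgt : (13 : ℝ) / 200 < sInf {κ : ℝ | (∀ (v : EuclideanSpace ℝ (Fin 3) → EuclideanSpace ℝ (Fin 3)) (M B : ℝ), ContDiff ℝ (⊤ : ℕ∞) v → Literature.Analysis.FluidPDE.VectorCalculus.IsDivFree v → (∀ x, ‖v x‖ ≤ M) → (∀ x, ‖fderiv ℝ v x‖ ≤ B) → (∫⁻ x, ‖iteratedFDeriv ℝ 0 v x‖ₑ ^ 2 < ⊤) → (∫⁻ x, ‖iteratedFDeriv ℝ 1 v x‖ₑ ^ 2 < ⊤) → (∫⁻ x, ‖iteratedFDeriv ℝ 2 v x‖ₑ ^ 2 < ⊤) → |∫ x, ⟪Literature.Analysis.FluidPDE.curl v x, fderiv ℝ v x (Literature.Analysis.FluidPDE.curl v x)⟫_ℝ| ≤ κ * M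 * Real.sqrt (∫ x, ‖Literature.Analysis.FluidPDE.curl v x‖ ^ 2) * Real.sqrt (∫ x, Literature.Analysis.FluidPDE.frobeniusNormSq (fderiv ℝ (Literature.Analysis.FluidPDE.curl v) x)))} := sharpDepletion_gt
  have hκpos : (0 : ℝ) < sInf {κ : ℝ | (∀ (v : EuclideanSpace ℝ (Fin 3) → EuclideanSpace ℝ (Fin 3)) (M B : ℝ), ContDiff ℝ (⊤ : ℕ∞) v → Literature.Analysis.FluidPDE.VectorCalculus.IsDivFree v → (∀ x, ‖v x‖ ≤ M) → (∀ x, ‖fderiv ℝ v x‖ ≤ B) → (∫⁻ x, ‖iteratedFDeriv ℝ 0 v x‖ₑ ^ 2 < ⊤) → (∫⁻ x, ‖iteratedFDeriv ℝ 1 v x‖ₑ ^ 2 < ⊤) → (∫⁻ x, ‖iteratedFDeriv ℝ 2 v x‖ₑ ^ 2 < ⊤) → |∫ x, ⟪Literature.Analysis.FluidPDE.curl v x, fderiv ℝ v x (Literature.Analysis.FluidPDE.curl v x)⟫_ℝ| ≤ κ * M * Real.sqrt (∫ x, ‖Literature.Analysis.FluidPDE.curl v x‖ ^ 2) * Real.sqrt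 (∫ x, Literature.Analysis.FluidPDE.frobeniusNormSq (fderiv ℝ (Literature.Analysis.FluidPDE.curl v) x)))} := lt_trans (by norm_num) hκgt
  have hm0 : (0 : ℝ) ≤ max β 0 := le_max_right _ _
  have hA0 : (0 : ℝ) ≤ max β 0 * L := mul_nonneg hm0 hLpos.le
  refine ⟨Real.sqrt (max β 0) / sInf {κ : ℝ | (∀ (v : EuclideanSpace ℝ (Fin 3) → EuclideanSpace ℝ (Fin 3)) (M B : ℝ), ContDiff ℝ (⊤ : ℕ∞) v → Literature.Analysis.FluidPDE.VectorCalculus.IsDivFree v → (∀ x, ‖v x‖ ≤ M) → (∀ x, ‖fderiv ℝ v x‖ ≤ B) → (∫⁻ x, ‖iteratedFDeriv ℝ 0 v x‖ₑ ^ 2 < ⊤) → (∫⁻ x, ‖iteratedFDeriv ℝ 1 v x‖ₑ ^ 2 < ⊤) → (∫⁻ x, ‖iteratedFDeriv ℝ 2 v x‖ₑ ^ 2 < ⊤) → |∫ x, ⟪Literature.Analysis.FluidPDE.curl v x, fderiv ℝ v x (Literature.Analysis.FluidPDE.curl v x)⟫_ℝ| ≤ κ * M * Real.sqrt (∫ x,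 ‖Literature.Analysis.FluidPDE.curl v x‖ ^ 2) * Real.sqrt (∫ x, Literature.Analysis.FluidPDE.frobeniusNormSq (fderiv ℝ (Literature.Analysis.FluidPDE.curl v) x)))}, div_nonneg (Real.sqrt_nonneg _) hκpos.le, ?_, ?_⟩
  · rw [div_lt_one hκpos, Real.sqrt_lt' hκpos]
    exact max_lt hβlt (by positivity)
  intro κ hκ C ν T hC hν hT u p hcl hLH hdec hrate hsing
  have hκle : sInf {κ : ℝ | (∀ (v : EuclideanSpace ℝ (Fin 3) → EuclideanSpace ℝ (Fin 3)) (M B : ℝ), ContDiff ℝ (⊤ : ℕ∞) v → Literature.Analysis.FluidPDE.VectorCalculus.IsDivFree v → (∀ x, ‖v x‖ ≤ M) → (∀ x, ‖fderiv ℝ v x‖ ≤ B) → (∫⁻ x, ‖iteratedFDeriv ℝ 0 v x‖ₑ ^ 2 < ⊤) → (∫⁻ x, ‖iteratedFDeriv ℝ 1 v x‖ₑ ^ 2 < ⊤) → (∫⁻ x, ‖iteratedFDeriv ℝ 2 v x‖ₑ ^ 2 < ⊤) → |∫ x, ⟪Literature.Analysis.FluidPDE.curl v x, fderiv ℝ v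 x (Literature.Analysis.FluidPDE.curl v x)⟫_ℝ| ≤ κ * M * Real.sqrt (∫ x, ‖Literature.Analysis.FluidPDE.curl v x‖ ^ 2) * Real.sqrt (∫ x, Literature.Analysis.FluidPDE.frobeniusNormSq (fderiv ℝ (Literature.Analysis.FluidPDE.curl v) x)))} ≤ κ := sharpDepletion_le hκ
  -- Step 2: along this flow, some admissible coefficient k and onset t₁ have only subextremal long windows.
  have hk : ¬ (∀ (k : ℝ → ℝ), Measurable k → (∀ τ, 0 ≤ k τ ∧ k τ ≤ 1) → (∀ t ∈ Set.Ico 0 T, ∀ M : ℝ, (∀ x, ‖u t x‖ ≤ M) → |∫ x, ⟪Literature.Analysis.FluidPDE.curl (u t) x, fderiv ℝ (u t) x (Literature.Analysis.FluidPDE.curl (u t) x)⟫_ℝ| ≤ k t * M * Real.sqrt (∫ x, ‖Literature.Analysis.FluidPDE.curl (u t) x‖ ^ 2) * Real.sqrt (∫ x, Literature.Analysis.FluidPDE.frobeniusNormSq (fderiv ℝ (Literature.Analysis.FluidPDE.curl (u t)) x))) → ∀ t₁ ∈ Set.Ico 0 T, ∃ s₁ s₂ : ℝ, t₁ ≤ s₁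 ∧ s₁ < s₂ ∧ s₂ < T ∧ L ≤ Real.log ((T - s₁) / (T - s₂)) ∧ β * Real.log ((T - s₁) / (T - s₂)) < ∫ τ in s₁..s₂, k τ ^ 2 / (T - τ)) := fun hall =>
    hrest ⟨C, ν, T, u, p, hC, hν, hT, hcl, hLH, hdec, hrate, hsing, hall⟩
  obtain ⟨k, hk1⟩ := not_forall.mp hk
  obtain ⟨hkm, hk2⟩ := Classical.not_imp.mp hk1
  obtain ⟨hk01, hk3⟩ := Classical.not_imp.mp hk2
  obtain ⟨hclause, hk4⟩ := Classical.not_imp.mp hk3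
  obtain ⟨t₁, ht₁'⟩ := not_forall.mp hk4
  obtain ⟨ht₁, hnowin⟩ := Classical.not_imp.mp ht₁'
  have hwin : ∀ s₁ s₂ : ℝ, t₁ ≤ s₁ → s₁ < s₂ → s₂ < T → L ≤ Real.log ((T - s₁) / (T - s₂)) →
      ∫ τ in s₁..s₂, k τ ^ 2 / (T - τ) ≤ β * Real.log ((T - s₁) / (T - s₂)) :=
    fun s₁ s₂ h1 h2 h3 h4 => not_lt.mp fun hlt => hnowin ⟨s₁, s₂, h1, h2, h3, h4, hlt⟩
  have hTt₁ : 0 < T - t₁ := sub_pos.mpr ht₁.2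
  -- Step 3: geometric blocks of log-length exactly L carry mass ≤ max β 0 · L.
  have hblock : ∀ n : ℕ, ∫ τ in (T - (T - t₁) * Real.exp (-(n * L)))..(T - (T - t₁) * Real.exp (-((n + 1) * L))), k τ ^ 2 / (T - τ) ≤ max β 0 * L := by
    intro n
    have hn : (0 : ℝ) ≤ n := n.cast_nonneg
    have he1 : Real.exp (-(n * L)) ≤ 1 := by
      rw [Real.exp_le_one_iff]
      have := mul_nonneg hn hLpos.le
      linarith
    have he2 : Real.exp (-((n + 1) * L)) < Real.exp (-(n * L)) := by
      rw [Real.exp_lt_exp]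
      have : ((n : ℝ) + 1) * L = n * L + L := by ring
      rw [this]
      linarith
    have h1 : t₁ ≤ (T - (T - t₁) * Real.exp (-(n * L))) := by
      have := mul_le_mul_of_nonneg_left he1 hTt₁.le
      linarith
    have h2 : (T - (T - t₁) * Real.exp (-(n * L))) < (T - (T - t₁) * Real.exp (-((n + 1) * L))) := by
      have := mul_lt_mul_of_pos_left he2 hTt₁
      linarith
    have h3 : (T - (T - t₁) * Real.exp (-((n + 1) * L))) < T := by
      have := mul_pos hTt₁ (Real.exp_pos (-((n + 1) * L)))
      linarith
    have hratio : (T - (T - (T - t₁) * Real.exp (-(n * L)))) / (T - (T - (T - t₁) * Real.exp (-((n + 1) * L)))) = Real.exp L := by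
      rw [show T - (T - (T - t₁) * Real.exp (-(n * L))) = (T - t₁) * Real.exp (-(n * L)) by ring,
        show T - (T - (T - t₁) * Real.exp (-((n + 1) * L))) = (T - t₁) * Real.exp (-((n + 1) * L)) by ring,
        mul_div_mul_left _ _ hTt₁.ne', ← Real.exp_sub]
      congr 1
      ring
    have hlog : Real.log ((T - (T - (T - t₁) * Real.exp (-(n * L)))) / (T - (T - (T - t₁) * Real.exp (-((n + 1) * L))))) = L := by
      rw [hratio, Real.log_exp]
    have hw := hwin (T - (T - t₁) * Real.exp (-(n * L))) (T - (T - t₁) * Real.exp (-((n + 1) * L))) h1 h2 h3 (le_of_eq hlog.symm)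
    rw [hlog] at hw
    exact hw.trans (mul_le_mul_of_nonneg_right (le_max_left _ _) hLpos.le)
  -- Step 4: sum the blocks (tree lemma) and restrict the flow-wise clause to [t₁, T).
  have hmain := blocksToLog_general (g := fun τ => k τ ^ 2 / (T - τ)) (t₁ := t₁) (T := T) (A := max β 0 * L) (ℓ := L)
    ht₁.2 hA0 hLpos (fun τ hτ => div_nonneg (sq_nonneg _) (sub_nonneg.mpr (le_of_lt hτ.2)))
    (fun t ht => intervalIntegrable_coeff_sq_div hkm hk01 ht.1 ht.2) hblock
  refine ⟨t₁, ht₁, k, max β 0 * L, hkm, hk01, fun t ht M hM => hclause t ⟨ht₁.1.trans ht.1, ht.2⟩ M hM, fun t ht => ?_⟩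
  have h := hmain t ht
  have hlog0 : 0 ≤ Real.log ((T - t₁) / (T - t)) := by
    apply Real.log_nonneg
    rw [le_div_iff₀ (sub_pos.mpr ht.2)]
    linarith [ht.1]
  have hcoef : max β 0 * L / L ≤ (Real.sqrt (max β 0) / sInf {κ : ℝ | (∀ (v : EuclideanSpace ℝ (Fin 3) → EuclideanSpace ℝ (Fin 3)) (M B : ℝ), ContDiff ℝ (⊤ : ℕ∞) v → Literature.Analysis.FluidPDE.VectorCalculus.IsDivFree v → (∀ x, ‖v x‖ ≤ M) → (∀ x, ‖fderiv ℝ v x‖ ≤ B) → (∫⁻ x, ‖iteratedFDeriv ℝ 0 v x‖ₑ ^ 2 < ⊤) → (∫⁻ x, ‖iteratedFDeriv ℝ 1 v x‖ₑ ^ 2 < ⊤) → (∫⁻ x, ‖iteratedFDeriv ℝ 2 v x‖ₑ ^ 2 < ⊤) → |∫ x, ⟪Literature.Analysis.FluidPDE.curl v x, fderiv ℝ v x (Literature.Analysis.FluidPDE.curl v x)⟫_ℝ| ≤ κ * M * Real.sqrt (∫ x, ‖Literature.Analysis.FluidPDE.curl v x‖ ^ 2) * Real.sqrt (∫ x, Literature.Analysis.FluidPDE.frobeniusNormSq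 (fderiv ℝ (Literature.Analysis.FluidPDE.curl v) x)))} * κ) ^ 2 := by
    rw [mul_div_assoc, div_self hLpos.ne', mul_one, div_mul_eq_mul_div, div_pow, mul_pow, Real.sq_sqrt hm0,
      le_div_iff₀ (pow_pos hκpos 2)]
    exact mul_le_mul_of_nonneg_left (pow_le_pow_left₀ hκpos.le hκle 2) hm0
  exact h.trans (add_le_add (mul_le_mul_of_nonneg_right hcoef hlog0) le_rfl)

-- audit (REV 1.5): the composition concludes the crux BY NAME; sorries only in the three stubs (K2, T2b, T3); T1, K1a, T2(a), T4 and the dynamic rigidity are proved.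
#print axioms bernoulliLiouville

#print axioms extremalAncient_false_of_bernoulli

#print axioms NearExtremalTransience_of

end Summit.NavierStokesRegularity.NavierStokesRegularity.Cruxes.NearExtremalTransience.BernoulliLiouville
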